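import Literature.MathematicalPhysics.QuantumFieldTheory.Balaban1983to89.Beta.InterLevelTransport
import Literature.MathematicalPhysics.QuantumFieldTheory.Balaban1983to89.Beta.KKTFluctuationUnique
import Literature.MathematicalPhysics.QuantumFieldTheory.Balaban1983to89.Beta.StepDriftWitness

/-!
# Composition of the block-averaging resolvent kernels across averaging levels — structural part

`[B5] §1 (1.8)–(1.14), (1.47)–(1.60)`-side bookkeeping (label corrected in v4.2, see Sources below) for the β-function sub-cell of the Bałaban audit (node
`BETA-an5-g13-RESOLVENT-COMPOSITION`, the leaf DELEGATED by the `HessianTelescoping` interface owner: «prove (K1a)–(K1c)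
for the explicit kernels `Gam` / `wH` / `GamΦ` / `wΦ`»).

HONEST FRAMING (cell rule, verbatim).  Discharging `FlowStep.BetaPertH` would make Bałaban's ultraviolet stability
theorem UNCONDITIONAL — a real constructive-QFT result; it is NOT the continuum limit and NOT the Clay Millennium
problem.  This file is lattice linear algebra / discrete analysis over the typed objects of the `Beta/` tree
(`Beta/KernelSpecInstance`, `Beta/KKTFluctuationKernel`, `Beta/KKTFluctuationEnergy`, `Beta/KKTFluctuationUnique`,
`Beta/OneStepResolventKernel`, `Beta/OneStepKernelFamily`, `Beta/InterLevelTransport`).  Every statement is [folklore]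
and kernel-checked; NO published theorem is cited as a hypothesis, NO `Prop` is minted as a named fact, and the
manuscripts under audit are used for ORIENTATION ONLY (ABSOLUTE RULE of the cell: no internally-minted statement enters
as a cited fact; the manuscripts are not citable for their own disputed steps).

## What is here, and why

The one-step response kernel of averaging level `N`, `OneStepResolventKernel.KInv (N := N)`, has the four blocks
`Γ_N = Gam` (fine–fine: the constrained covariance), `ℋ_N = wH` (fine–coarse: the minimiser), `ℋ♭_N = GamΦ`
(coarse–fine) and `−𝒞_N = wΦ` (coarse–coarse).  The interface owner's sketch (`ResolventComposition.sketch.v1`, gen 8,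
not in the tree; journal REQUEST (K1′)) proposes three KERNEL-LEVEL composition identities (K1a′)/(K1b′)/(K1c′) between
the levels `L^j` and `L^(j+1)` through `OneStepKernelFamily.KInvStep L j = dec (L^j) (KInv (N := L^(j+1)))` and the
weighted sublattice lift `InterLevelTransport.liftW`, bundled for `j ≥ 1` as `KKTComposable L`.  This file proves the
STRUCTURAL facts behind them, DECIDES all three at the bottom level `j = 0` (§1–§4), REFUTES (K1c′) and the bundle as typed
(§5), and PROVES the sign-corrected (K1b′), (K1c⁻) AT EVERY LEVEL `j` (§6); the transverse (K1aᵀ) at every level is the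
companion leaf `Beta/ResolventCompositionStepB` (`k1aTrans`, `k1_trio`), for which §7–§8 here are the preparation:

* §1 `codiff₁ ∘ curvAdj = 0` and `codiff₁ (𝒬ᵀ_N φ) (x) = (codiff₁ φ) (quo N x)` (so it is `N`-block-constant); hence
  **the gauge multiplier of every minimiser column vanishes identically**, `wM_eq_zero : wM (N := N) l = 0` — an
  energy argument: `Δ₀² wM` is block-constant by (EL), pairs to zero with `wM` by (M), two adjunctions give
  `∑ |Δ₀ wM|² = 0`, then `∑ |d wM|² = 0`, then `wM = 0` by summability.  (The gauge multiplier `GamM` of a covariance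
  column does NOT vanish: its force `δ_b` is not co-closed.)
* §2 the translated minimiser columns `Hcol` and **the antisymmetry of the off-diagonal blocks**
  `GamΦ_eq_neg_wH : GamΦ (N := N) l' q l x' = − wH (N := N) l l' (x' − N • q)` (`ℋ♭ = −ℋᵀ`), by Green-pairing the
  (EL) identity of the covariance column against the minimiser column and back (toolkit of `KKTFluctuationEnergy`);
  the sign is that of the typed KKT system `SolvesKKT`, whose (EL) row carries `+ 𝒬ᵀ φ` on the right-hand side.
* §3 the bottom level in closed form: `wH_one : wH (N := 1) κ l z = δ_{κl} δ_{z0}` and `Gam_one : Gam (N := 1) = 0`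
  (uniqueness of tempered KKT solutions, `KKTFluctuationUnique`, against the explicit trivial solutions), hence the
  blocks of `KInv (N := 1)` (`0`, `𝟙`, `−𝟙`), the composition rules `comp_KInv_left_of_eq_one` /
  `comp_KInv_right_of_eq_one`, and `lift 1`/`liftW 1`/`dec 1`/`KInvStep L 0` in closed form.
* §4 VERBATIM copies `K1a'`, `K1b'`, `K1c'`, `KKTComposable` of the interface predicates (so that consumers bind by
  name on a tree file) and their DECISION at `j = 0`: `k1b'_zero : K1b' L 0` HOLDS; `not_k1c'_zero : ¬ K1c' L 0` (it
  says `ℋ_L ≡ 0`: the sign of the composite is wrong, `ℋ♭ = −ℋᵀ`); `k1a'_zero_iff : K1a' L 0 ↔ (Gam (N := L) ≡ 0)`.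
  The sign-corrected predicates `K1cNeg` (proved for all `j` in §6), `K1aNeg` (true at `j = 0`, numerically FALSE
  entrywise for `j ≥ 1`: gauge-slice defect) and the TRANSVERSE covariance telescoping `K1aTrans` (proved for all `j`
  in the companion leaf `Beta/ResolventCompositionStepB`) are defined and each is CONSUMED by its `j = 0` theorem.

* §5 (v1.1) **(K1c′) IS FALSE AT EVERY STEP and the bundle `KKTComposable L` is false as typed**, for every `L ≥ 1`
  and every `d`: `not_k1c' : ¬ K1c' L j`, `not_kktComposable : ¬ KKTComposable L` — a FINITE CONTOUR-SUM COUNT: the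
  contour sum `𝒬_{L^(j+1)}` in the fine variable, applied to both sides of (K1c′) at the coarse origin, gives `−1` on the
  left (`ℋ♭ = −ℋᵀ`, `wH_Q`) and `+1` on the right (the composite is a superposition of level-`L^j` minimiser columns,
  `compC_apply`, whose `𝒬_{L^j}` returns the coefficients, `contourSum_compC`; then `StepDriftWitness.contourSum_compose`
  and `sum_KInvStep_inr_inl : Σ_{L-contour} KInvStep L j (0, ·; inr μ, inl μ) = −(L^j)^{−(d+2)}`).

* §6 (v2) **(K1b′) AND (K1c⁻) HOLD AT EVERY STEP `j`**: `k1b' : K1b' L j`, `k1cNeg : K1cNeg L j` (every `L ≥ 1`, every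
  `d`).  The engine is `wH_reproduction`: for `N′ = ML` the translated level-`N′` minimiser column `T = ℋ_{N′}(·; μ, z)` is
  REPRODUCED by the level-`M` columns, `T = Σ_{b′} (𝒬_M T)(b′) ℋ_M(·; b′)` — proved by GREEN PAIRING `T` against the
  Euler–Lagrange identity of the level-`M` covariance column (as in §2; no uniqueness theorem, no torus): the
  `𝒬_Mᵀ Φ^Γ` term gives minus the superposition (`ℋ♭ = −ℋᵀ`), the gauge term dies because `T`'s gauge quantity is
  `N′`-block-constant hence `M`-block-constant (`isBlockConst_of_mul`) against the zero block means of `Γ`'s gauge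
  multiplier, the unit force gives `T`; and the same pairing vanishes by `T`'s own Euler–Lagrange identity since
  `𝒬_{ML} = 𝒬_L 𝒬_M` (`contourSum_mul`, the base-point-free semigroup law) and `𝒬_M Γ_M = 0`.  The coefficients of the
  two composites are identified by `KInvStep_inl_inr` / `KInvStep_inr_inl` (the mixed entries of the decimated resolvent
  at a coarse argument are `±(L^j)^{−(d+2)} 𝒬_{L^j} T`) and the sublattice re-indexing of §5 (`compB_apply`, `compC_apply'`).

* §7 (v3) TOWARDS THE ALL-`j` (K1aᵀ) — COVARIANCE FIELDS WITH CO-CLOSED FORCES: for a finite combination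
  `U = Σ a_b Γ_b` (`KKTFluctuationEnergy.GcolSum`) whose force `Σ a_b δ_b` is co-closed, **its gauge multiplier vanishes**
  (`McolSum_eq_zero`, the §1 mechanism with `codiff₁ ∘ curvAdj = 0` and the co-closed force; false for generic forces —
  the gauge-slice defect), and **the two-level decomposition** `U_{ML} = U_M + Σ_{(l″,w′)} (𝒬_M U_{ML})(l″,w′) · ℋ_M(·; l″,w′)`
  (`GcolSum_decomposition`, the §6 pairing engine; the cross gauge term is where `McolSum_eq_zero` enters).

* §8 (v4) (S2) OF THE ALL-`j` PLAN — FLATNESS AND COARSE CO-CLOSEDNESS: for finite superpositions `H = Σ_t c_t ℋ_N(·; t)`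
  of translated minimiser columns (`HcolSum`), the constraint multiplier is COARSE CO-CLOSED (`codiff₁_HΦcolSum`:
  `codiff₁ ∘ curvAdj = 0` + `codiff₁_contourSumAdj`), the ENERGY IDENTITY `Σ |curv H|² = Σ_t c_t Φ^H(t)`
  (`lip2_curv_HcolSum`), hence **the minimiser field of the coarse exact datum `−d_c δ_{y₀}` is FLAT**
  (`curv_HcolSum_Tex`); the LATTICE POINCARÉ LEMMA `H¹(ℤ^D) = 0` with an explicit staircase potential (`dz_stairPot`,
  `exists_dz_eq_of_curv_eq_zero`); summation by parts against finitely supported forms (`lip1_dz_of_finite`); and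
  **(S2) `codiff₁_lip1_Hcol`: `ℋ_Nᵀ` maps finitely supported co-closed test forms to COARSE CO-CLOSED forms.**

What remained after v4 — the last step (B) of the all-`j` TRANSVERSE covariance telescoping (K1aᵀ) — is DONE in the companion
leaf `Beta/ResolventCompositionStepB` (split off only because this one-writer leaf reached the gate's size limit):
`ResolventCompositionStepB.k1aTrans : K1aTrans L j` and `ResolventCompositionStepB.k1_trio : K1b′ L j ∧ K1cNeg L j ∧ K1aTrans L j`
for every `j`, by the superposition `V = Γ_{ML} 𝒬_Mᵀ ℋ_Mᵀ F′` (no gauge term since its force is co-closed, §7/§8 here),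
the general two-level decomposition of (EL)+(G) fields, and (Q) of `Γ_M`.  Nothing of the K1 trio remains; (K1c′) and
`KKTComposable` stay refuted as typed (§5).  Numerical evidence for every step (exact to rounding on the periodised torus;
NOT load-bearing) is recorded in the node's `NUMERICS.md` v2.

VERSIONS.  v1 (p188919): §1–§4.  v1.1 (p189058): + `import …Beta.StepDriftWitness`, + §5.  v2 (p189188): + §6.  v3
(p189420): + §7.  v4 (p189776): + §8; §1–§7 unchanged.  v4.1 (p190442): DOCSTRINGS ONLY (this header and the status
words of two §4 docstrings now point to the companion leaf `Beta/ResolventCompositionStepB`); no declaration changed.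
v4.2 (this file, an5 gen 14): DOCSTRINGS ONLY — the orientation-source labels of this header corrected (ERRATUM under
Sources); every declaration byte-identical to v4.1.

Sources [orientation only; nothing is cited as a hypothesis]: [B5] = T. Bałaban, Propagators and renormalization
transformations for lattice gauge theories. I, Commun. Math. Phys. 95 (1984) 17–40, §1 — the averaging operation,
the axial gauge conditions and the renormalization transformation (1.8)–(1.14) (p. 19), the constrained variational
problem / minimal configuration §1 D (1.47)–(1.50) (p. 26), and «This defines the operator H_kB = A» (1.59)–(1.60)
(p. 28). ERRATUM (v4.2, docstring only; XREAD C-sb14-53 DOCFIX D1, strat-b14-g20, journal l.54336): the earlier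
versions labelled these orientation windows «[B12] = Commun. Math. Phys. 122 (1989) 175–202, §1» and «[B09] = Commun.
Math. Phys. 116 (1988) 1–22, §1 (1.7)–(1.12)»; in `HOME/inputs/INDEX.md` CMP 122:175–202 is B15 (large field
renormalization I) and CMP 116:1–22 is B13 (cluster expansions), and neither §1 contains the windows meant — the objects of
this file (block averaging Q, gauge slice, constrained minimiser H, fluctuation covariance) are those of B5 §1. Nothing was or
is cited from any of these papers; no declaration changed.
-/

namespace Literature.MathematicalPhysics.QuantumFieldTheory.Balaban1983to89.Beta.ResolventComposition

noncomputable section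

open Literature.Probability.LatticeModels (TorusSite Torus.proj Torus.proj_apply)
open AffineAveraging (Form0 Form1 Form2 unitVec unitVec_apply dz curv curvAdj codiff₁ box toSite blockSum
  contourSum)
open AffineReproduction (contourSumAdj IsBlockConst)
open LatticeForm (repZ quo proj_repZ)
open BlochFibreUniqueness (quo_add_zsmul quo_repZ)
open KernelSpecInstance (wH wΦ wM wH_EL wH_G wH_Q decay_wH decay_wM decay_wΦ codiff₁_add opEL_shift opG_shift
  opM_shift contourSum_shift contourSumAdj_shift)
open KKTFluctuationKernel (Gam GamΦ GamM delta1 delta1_apply Gam_EL Gam_G GamM_M Gam_Q decay_Gam)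
open KKTFluctuationEnergy (lip0 lip1 lip2 lip2_comm summable_shift summable_shift_sub summable_mul_of_bdd
  summable_mul_of_bdd' abs_dz_le abs_codiff₁_le abs_curv_le abs_contourSumAdj_le summable_dz summable_codiff₁ summable_curv lip1_add
  lip1_curvAdj lip1_dz lip0_codiff₁ tsum_mul_eq_zero_of_blockConst quo_zsmul_add_toSite contourSumAdj_eq
  lip1_contourSumAdj Gcol Mcol Φcol δcol curvAdj_curv_Gcol Gcol_bdd_summable Mcol_bdd_summable Φcol_bdd
  lip1_Gcol_contourSumAdj lip1_Gcol_gauge lip1_Gcol_δcol)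
open KKTFluctuationUnique (SolvesKKT Tempered0 Tempered1 unique_of_solvesKKT wM_M solvesKKT_wH abs_le_of_decay510
  solvesKKT_Gam tempered_Gam tempered_GamΦ tempered_GamM eq_Gam_of_solvesKKT eq_wH_of_solvesKKT)
open DecimatedMomentLimit (summable_of_decay510)
open OneStepResolventKernel (Fib KInv KInv_inl_inl KInv_inr_inl_coarse)
open B12Sec2to5 (l1 l1_nonneg Decay510)

variable {D N : ℕ}

/-! ## §1 `δ ∘ (d*)= 0`, `δ 𝒬ᵀ` is block-constant, and the gauge multiplier of the minimiser vanishes -/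

/-- `codiff₁ ∘ curvAdj = 0` (`δ² = 0` read through the adjoint: `⟨δ d* F, f⟩ = ⟨F, d d f⟩ = 0`), as a pointwise algebraic
identity valid for every 2-form (no antisymmetry needed). [folklore] -/
theorem codiff₁_curvAdj (F : Form2 D ℝ) : codiff₁ (curvAdj F) = 0 := by
  funext x
  simp only [codiff₁, curvAdj, Pi.zero_apply, Finset.sum_add_distrib, Finset.sum_sub_distrib]
  have h1 : ∀ κ l : Fin D, x - unitVec κ - unitVec l = x - unitVec l - unitVec κ := fun κ l => by abel
  have e1 : ∑ κ : Fin D, ∑ l : Fin D, F κ l (x - unitVec κ - unitVec l)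
      = ∑ κ : Fin D, ∑ l : Fin D, F l κ (x - unitVec κ - unitVec l) := by
    rw [Finset.sum_comm]
    exact Finset.sum_congr rfl fun κ _ => Finset.sum_congr rfl fun l _ => by rw [h1]
  have e2 : ∑ κ : Fin D, ∑ l : Fin D, F κ l (x - unitVec κ) = ∑ κ : Fin D, ∑ l : Fin D, F l κ (x - unitVec l) := by
    rw [Finset.sum_comm]
  have e3 : ∑ κ : Fin D, ∑ l : Fin D, F l κ (x - unitVec l) = ∑ κ : Fin D, ∑ l : Fin D, F l κ (x - unitVec l) := rfl
  have e4 : ∑ κ : Fin D, ∑ l : Fin D, F κ l x = ∑ κ : Fin D, ∑ l : Fin D, F l κ x := by rw [Finset.sum_comm]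
  have e5 : ∑ κ : Fin D, ∑ l : Fin D, F κ l (x - unitVec l) = ∑ κ : Fin D, ∑ l : Fin D, F l κ (x - unitVec κ) := by
    rw [Finset.sum_comm]
  linarith [e1, e2, e4, e5]

/-- `codiff₁ (𝒬ᵀ_N φ) (x) = (codiff₁ φ) (quo N x)`: the contour sums along the axis `κ` through `x − e_κ` and through `x`
differ by their end blocks (a telescoping sum over `s ∈ range N`). [folklore] -/
theorem codiff₁_contourSumAdj [NeZero N] (φ : Form1 D ℝ) (x : AffineAveraging.Site D) :
    codiff₁ (contourSumAdj N φ) x = codiff₁ φ (quo N x) := by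
  simp only [codiff₁, contourSumAdj_eq]
  refine Finset.sum_congr rfl (fun κ _ => ?_)
  have h1 : ∀ s : ℕ, x - unitVec κ - (s : ℤ) • unitVec κ = x - ((s + 1 : ℕ) : ℤ) • unitVec κ := by
    intro s; push_cast; rw [add_smul, one_smul]; abel
  simp_rw [h1]
  rw [← Finset.sum_sub_distrib, Finset.sum_range_sub (fun s => φ κ (quo N (x - (s : ℤ) • unitVec κ)))]
  have h2 : x - ((N : ℕ) : ℤ) • unitVec κ = x + (N : ℤ) • (-unitVec κ) := by rw [smul_neg, sub_eq_add_neg]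
  simp only [Nat.cast_zero, zero_smul, sub_zero]
  rw [h2, quo_add_zsmul, ← sub_eq_add_neg]

/-- `quo N (N • u) = u` in any dimension. [folklore] -/
theorem quo_zsmul' [NeZero N] (u : AffineAveraging.Site D) : quo N ((N : ℤ) • u) = u := by
  funext j
  simp only [quo, Pi.smul_apply, smul_eq_mul]
  exact Int.mul_ediv_cancel_left _ (by exact_mod_cast NeZero.ne N)

/-- Hence `codiff₁ (𝒬ᵀ_N φ)` is constant on `N`-blocks. [folklore] -/
theorem isBlockConst_codiff₁_contourSumAdj [NeZero N] (φ : Form1 D ℝ) : IsBlockConst N (codiff₁ (contourSumAdj N φ)) := by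
  intro y b hb
  rw [codiff₁_contourSumAdj, codiff₁_contourSumAdj, quo_zsmul_add_toSite y hb, quo_zsmul']

/-- A summable function invariant under a nonzero translation vanishes. [folklore] -/
theorem eq_zero_of_summable_of_shift_invariant {f : AffineAveraging.Site D → ℝ} (hf : Summable f)
    {v : AffineAveraging.Site D} (hv : v ≠ 0) (hinv : ∀ x, f (x + v) = f x) : f = 0 := by
  funext x
  have hn : ∀ n : ℕ, f (x + (n : ℤ) • v) = f x := by
    intro n
    induction n with
    | zero => simp
    | succ n ih => rw [show x + ((n + 1 : ℕ) : ℤ) • v = (x + (n : ℤ) • v) + v by push_cast; rw [add_smul, one_smul, add_assoc],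
        hinv, ih]
  have hinj : Function.Injective (fun n : ℕ => x + (n : ℤ) • v) := by
    intro m n h
    have h' : ((m : ℤ) - (n : ℤ)) • v = 0 := by
      rw [sub_smul]; exact sub_eq_zero.mpr (add_left_cancel h)
    rcases smul_eq_zero.mp h' with h'' | h''
    · exact_mod_cast sub_eq_zero.mp h''
    · exact absurd h'' hv
  have ht : Filter.Tendsto (fun n : ℕ => f (x + (n : ℤ) • v)) Filter.cofinite (nhds 0) :=
    hf.tendsto_cofinite_zero.comp hinj.tendsto_cofinite
  rw [Nat.cofinite_eq_atTop] at ht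
  simp_rw [hn] at ht
  exact tendsto_nhds_unique tendsto_const_nhds ht

section MinimiserGauge

variable {d : ℕ} [NeZero N]

/-- **THE GAUGE MULTIPLIER OF THE MINIMISER VANISHES**: `wM (N := N) l = 0` for every source direction `l`.
Mechanism: by (EL) and §1, `Δ₀² wM = −codiff₁ (𝒬ᵀ wΦ)` is block-constant and bounded; by (M) it pairs to zero with
`wM`; two adjunctions turn that pairing into `∑ |Δ₀ wM|²`, so `Δ₀ wM = 0`; one more adjunction gives `∑ |d wM|² = 0`,
so `wM` is translation invariant, and a summable translation-invariant function is zero. [folklore] -/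
theorem wM_eq_zero (l : Fin (d + 1)) : wM (N := N) l = 0 := by
  set μ : Form0 (d + 1) ℝ := wM (N := N) l with hμdef
  obtain ⟨δ₃, C₃, hδ₃, h₃⟩ := decay_wM (N := N) (d := d)
  have hμs : Summable μ := summable_of_decay510 hδ₃ (h₃ l)
  have hμb : ∀ x, |μ x| ≤ C₃ := fun x => abs_le_of_decay510 hδ₃ (h₃ l) x
  obtain ⟨δ₂, C₂, hδ₂, h₂⟩ := decay_wΦ (N := N) (d := d)
  have hΦb : ∀ κ y, |(fun κ y => wΦ (N := N) κ l y) κ y| ≤ C₂ := fun κ y => abs_le_of_decay510 hδ₂ (h₂ κ l) y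
  -- (EL) as an identity of 1-forms, then `codiff₁` of it
  have hEL : curvAdj (curv (fun κ z => wH (N := N) κ l z))
      = contourSumAdj N (fun κ y => wΦ (N := N) κ l y) + dz (codiff₁ (dz μ)) := by
    funext κ x; rw [Pi.add_apply]; exact wH_EL (N := N) l κ x
  have hg : codiff₁ (dz (codiff₁ (dz μ))) = -codiff₁ (contourSumAdj N (fun κ y => wΦ (N := N) κ l y)) := by
    have h := congrArg codiff₁ hEL
    rw [codiff₁_curvAdj, codiff₁_add] at h
    exact eq_neg_of_add_eq_zero_right h.symm
  have hgc : IsBlockConst N (codiff₁ (dz (codiff₁ (dz μ)))) := by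
    intro y b hb
    rw [hg, Pi.neg_apply, Pi.neg_apply, isBlockConst_codiff₁_contourSumAdj _ y b hb]
  have hgb : ∀ x, |codiff₁ (dz (codiff₁ (dz μ))) x| ≤ (d + 1 : ℕ) * (2 * C₂) := by
    intro x
    rw [hg, Pi.neg_apply, abs_neg, codiff₁_contourSumAdj]
    exact abs_codiff₁_le hΦb _
  -- step 1: `∑' g·μ = 0`
  have hsum0 : ∑' x, codiff₁ (dz (codiff₁ (dz μ))) x * μ x = 0 :=
    tsum_mul_eq_zero_of_blockConst (N := N) hgb hgc hμs (wM_M (N := N) l)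
  -- step 2: two adjunctions
  have hdzμ : ∀ κ, Summable (dz μ κ) := fun κ => summable_dz hμs κ
  have hΔ : Summable (codiff₁ (dz μ)) := summable_codiff₁ hdzμ
  have hdzΔ : ∀ κ, Summable (dz (codiff₁ (dz μ)) κ) := fun κ => summable_dz hΔ κ
  have hdzμb : ∀ κ x, |dz μ κ x| ≤ 2 * C₃ := fun κ x => abs_dz_le hμb κ x
  have hΔb : ∀ x, |codiff₁ (dz μ) x| ≤ (d + 1 : ℕ) * (2 * (2 * C₃)) := fun x => abs_codiff₁_le hdzμb x
  have e1 : lip0 μ (codiff₁ (dz (codiff₁ (dz μ)))) = lip1 (dz μ) (dz (codiff₁ (dz μ))) := lip0_codiff₁ hμb hdzΔ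
  have e2 : lip1 (dz μ) (dz (codiff₁ (dz μ))) = lip0 (codiff₁ (dz μ)) (codiff₁ (dz μ)) := lip1_dz hdzμb hΔ
  have e0 : lip0 μ (codiff₁ (dz (codiff₁ (dz μ)))) = 0 := by
    unfold lip0
    rw [← hsum0]
    exact tsum_congr (fun x => mul_comm _ _)
  have hsq : ∑' x, codiff₁ (dz μ) x * codiff₁ (dz μ) x = 0 := by
    have h := e0
    rw [e1, e2] at h
    exact h
  -- step 3: `Δ₀ μ = 0`
  have hΔ0 : codiff₁ (dz μ) = 0 := by
    have hnn : ∀ x, 0 ≤ codiff₁ (dz μ) x * codiff₁ (dz μ) x := fun x => mul_self_nonneg _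
    have hs2 : Summable (fun x => codiff₁ (dz μ) x * codiff₁ (dz μ) x) := summable_mul_of_bdd hΔb hΔ
    have hz := (hasSum_zero_iff_of_nonneg hnn).1 (by rw [← hsq]; exact hs2.hasSum)
    funext x
    exact mul_self_eq_zero.mp (congr_fun hz x)
  -- step 4: `∑ |dμ|² = ⟨dμ, dμ⟩ = ⟨Δ₀ μ, μ⟩ = 0`
  have e3 : lip1 (dz μ) (dz μ) = lip0 (codiff₁ (dz μ)) μ := lip1_dz hdzμb hμs
  have hsq1 : ∑' x, ∑ κ, dz μ κ x * dz μ κ x = 0 := by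
    have h := e3
    rw [hΔ0] at h
    unfold lip1 lip0 at h
    simpa using h
  have hdz0 : ∀ κ x, dz μ κ x = 0 := by
    have hnn : ∀ x, 0 ≤ ∑ κ, dz μ κ x * dz μ κ x := fun x => Finset.sum_nonneg fun κ _ => mul_self_nonneg _
    have hs3 : Summable (fun x => ∑ κ, dz μ κ x * dz μ κ x) :=
      summable_sum fun κ _ => summable_mul_of_bdd (hdzμb κ) (hdzμ κ)
    have hz := (hasSum_zero_iff_of_nonneg hnn).1 (by rw [← hsq1]; exact hs3.hasSum)
    intro κ x
    have hx : ∑ κ, dz μ κ x * dz μ κ x = 0 := congr_fun hz x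
    exact mul_self_eq_zero.mp
      ((Finset.sum_eq_zero_iff_of_nonneg (fun κ _ => mul_self_nonneg (dz μ κ x))).1 hx κ (Finset.mem_univ κ))
  -- step 5: translation invariance + summability
  have hinv : ∀ x, μ (x + unitVec 0) = μ x := fun x => by
    have h := hdz0 0 x
    simp only [dz] at h
    linarith
  have hv : (unitVec 0 : AffineAveraging.Site (d + 1)) ≠ 0 := by
    intro h
    have := congr_fun h 0
    simp [unitVec_apply] at this
  exact eq_zero_of_summable_of_shift_invariant hμs hv hinv

/-- (EL) of the minimiser column WITHOUT gauge term: `d*d ℋ_l = 𝒬ᵀ (wΦ_l)`. [folklore] -/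
theorem wH_EL' (l μ : Fin (d + 1)) (x : AffineAveraging.Site (d + 1)) :
    curvAdj (curv (fun κ z => wH (N := N) κ l z)) μ x = contourSumAdj N (fun κ y => wΦ (N := N) κ l y) μ x := by
  rw [wH_EL, wM_eq_zero]
  simp [dz, codiff₁]

end MinimiserGauge

/-! ## §2 Translated minimiser columns and the antisymmetry `ℋ♭ = −ℋᵀ` -/

section Antisymmetry

variable {d : ℕ} [NeZero N]

/-- The minimiser column with source at the coarse bond `(l', q)`: `ℋ_N(·, (l', q)) = wH(·, l', · − N q)`. [folklore] -/
def Hcol (l' : Fin (d + 1)) (q : AffineAveraging.Site (d + 1)) : Form1 (d + 1) ℝ :=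
  fun κ z => wH (N := N) κ l' (z - (N : ℤ) • q)

/-- Its constraint multiplier. [folklore] -/
def HΦcol (l' : Fin (d + 1)) (q : AffineAveraging.Site (d + 1)) : Form1 (d + 1) ℝ :=
  fun κ y => wΦ (N := N) κ l' (y - q)

/-- Entries of `Hcol`. [folklore] -/
@[simp] theorem Hcol_apply (l' : Fin (d + 1)) (q : AffineAveraging.Site (d + 1)) (κ : Fin (d + 1))
    (z : AffineAveraging.Site (d + 1)) : Hcol (N := N) l' q κ z = wH (N := N) κ l' (z - (N : ℤ) • q) := rfl

/-- Entries of `HΦcol`. [folklore] -/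
@[simp] theorem HΦcol_apply (l' : Fin (d + 1)) (q : AffineAveraging.Site (d + 1)) (κ : Fin (d + 1))
    (y : AffineAveraging.Site (d + 1)) : HΦcol (N := N) l' q κ y = wΦ (N := N) κ l' (y - q) := rfl

/-- (EL) for the translated column: `d*d ℋ_{(l',q)} = 𝒬ᵀ Φ^ℋ_{(l',q)}` (no gauge term, §1). [folklore] -/
theorem curvAdj_curv_Hcol (l' : Fin (d + 1)) (q : AffineAveraging.Site (d + 1)) :
    curvAdj (curv (Hcol (N := N) l' q)) = contourSumAdj N (HΦcol (N := N) l' q) := by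
  funext μ x
  have h1 : curvAdj (curv (Hcol (N := N) l' q)) μ x = curvAdj (curv (fun κ z => wH (N := N) κ l' z)) μ (x - (N : ℤ) • q) :=
    opEL_shift (fun κ z => wH (N := N) κ l' z) ((N : ℤ) • q) μ x
  have h2 : contourSumAdj N (HΦcol (N := N) l' q) μ x
      = contourSumAdj N (fun κ y => wΦ (N := N) κ l' y) μ (x - (N : ℤ) • q) :=
    contourSumAdj_shift (fun κ y => wΦ (N := N) κ l' y) q μ x
  rw [h1, h2, wH_EL']

/-- (G) for the translated column. [folklore] -/
theorem isBlockConst_Hcol (l' : Fin (d + 1)) (q : AffineAveraging.Site (d + 1)) :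
    IsBlockConst N (codiff₁ (dz (codiff₁ (Hcol (N := N) l' q)))) := by
  intro y b hb
  have h := fun x => opG_shift (fun κ z => wH (N := N) κ l' z) ((N : ℤ) • q) x
  change codiff₁ (dz (codiff₁ (fun κ z => wH (N := N) κ l' (z - (N : ℤ) • q)))) ((N : ℤ) • y + toSite b)
    = codiff₁ (dz (codiff₁ (fun κ z => wH (N := N) κ l' (z - (N : ℤ) • q)))) ((N : ℤ) • y)
  rw [h, h, show (N : ℤ) • y + toSite b - (N : ℤ) • q = (N : ℤ) • (y - q) + toSite b by rw [smul_sub]; abel,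
    show (N : ℤ) • y - (N : ℤ) • q = (N : ℤ) • (y - q) by rw [smul_sub], wH_G l' (y - q) hb]

/-- (Q) for the translated column: unit UNNORMALISED contour sum at `(l', q)`, zero elsewhere. [folklore] -/
theorem contourSum_Hcol (l' : Fin (d + 1)) (q : AffineAveraging.Site (d + 1)) (κ : Fin (d + 1))
    (y : AffineAveraging.Site (d + 1)) :
    contourSum N (Hcol (N := N) l' q) κ y = if y = q ∧ κ = l' then 1 else 0 := by
  have h := contourSum_shift (N := N) (fun κ z => wH (N := N) κ l' z) q κ y
  change contourSum N (fun κ z => wH (N := N) κ l' (z - (N : ℤ) • q)) κ y = _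
  rw [h, wH_Q]
  simp only [sub_eq_zero]

/-- The translated column solves the force-free KKT system with block averages `δ_{(κ,y),(l',q)}` and ZERO gauge
multiplier. [folklore] -/
theorem solvesKKT_Hcol (l' : Fin (d + 1)) (q : AffineAveraging.Site (d + 1)) :
    SolvesKKT N 0 (fun κ y => if y = q ∧ κ = l' then 1 else 0) (Hcol (N := N) l' q) (HΦcol (N := N) l' q) 0 where
  el κ x := by
    rw [show curvAdj (curv (Hcol (N := N) l' q)) κ x = contourSumAdj N (HΦcol (N := N) l' q) κ x by
      rw [curvAdj_curv_Hcol]]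
    simp [dz, codiff₁]
  gauge := isBlockConst_Hcol l' q
  mean y := by simp [blockSum]
  avg κ y := contourSum_Hcol l' q κ y

/-- Uniform bound and summability of the translated minimiser columns. [folklore] -/
theorem Hcol_bdd_summable : ∃ C : ℝ, 0 ≤ C ∧ (∀ (l' : Fin (d + 1)) (q : AffineAveraging.Site (d + 1)) κ z,
    |Hcol (N := N) l' q κ z| ≤ C) ∧ ∀ (l' : Fin (d + 1)) (q : AffineAveraging.Site (d + 1)) κ,
      Summable (Hcol (N := N) l' q κ) := by
  obtain ⟨δ₁, C₁, hδ₁, h₁⟩ := decay_wH (N := N) (d := d)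
  have hC : 0 ≤ C₁ := (abs_nonneg _).trans (abs_le_of_decay510 hδ₁ (h₁ 0 0) 0)
  exact ⟨C₁, hC, fun l' q κ z => abs_le_of_decay510 hδ₁ (h₁ κ l') _,
    fun l' q κ => summable_shift_sub (summable_of_decay510 hδ₁ (h₁ κ l')) ((N : ℤ) • q)⟩

/-- Uniform bound of their constraint multipliers. [folklore] -/
theorem HΦcol_bdd : ∃ C : ℝ, 0 ≤ C ∧ ∀ (l' : Fin (d + 1)) (q : AffineAveraging.Site (d + 1)) κ y,
    |HΦcol (N := N) l' q κ y| ≤ C := by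
  obtain ⟨δ₂, C₂, hδ₂, h₂⟩ := decay_wΦ (N := N) (d := d)
  have hC : 0 ≤ C₂ := (abs_nonneg _).trans (abs_le_of_decay510 hδ₂ (h₂ 0 0) 0)
  exact ⟨C₂, hC, fun l' q κ y => abs_le_of_decay510 hδ₂ (h₂ κ l') _⟩

/-- Pairing the covariance column's (EL) against a minimiser column: the `𝒬ᵀΦ_b` term gives the multiplier entry
`Φ_b(l', q) = GamΦ l' q l x'` (by (Q) of the minimiser column). [folklore] -/
theorem lip1_Hcol_contourSumAdj (l' l : Fin (d + 1)) (q x' : AffineAveraging.Site (d + 1)) :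
    lip1 (Hcol (N := N) l' q) (contourSumAdj N (Φcol (N := N) l x')) = GamΦ (N := N) l' q l x' := by
  obtain ⟨C, _, hbdd, hsum⟩ := Hcol_bdd_summable (N := N) (d := d)
  obtain ⟨CΦ, _, hΦ⟩ := Φcol_bdd (N := N) (d := d)
  rw [lip1_contourSumAdj (N := N) (hsum l' q) (hΦ l x')]
  have e : ∀ y, ∑ κ, Φcol (N := N) l x' κ y * contourSum N (Hcol (N := N) l' q) κ y
      = if y = q then GamΦ (N := N) l' q l x' else 0 := by
    intro y
    simp only [contourSum_Hcol, mul_ite, mul_one, mul_zero]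
    by_cases hy : y = q
    · subst hy; simp [Φcol]
    · simp [hy]
  rw [tsum_congr e, tsum_eq_single q (fun y hy => if_neg hy), if_pos rfl]

/-- … the gauge term `dδd M_b` pairs to zero with a minimiser column ((G) of the column against (M) of `M_b`). [folklore] -/
theorem lip1_Hcol_gauge (l' l : Fin (d + 1)) (q x' : AffineAveraging.Site (d + 1)) :
    lip1 (Hcol (N := N) l' q) (dz (codiff₁ (dz (Mcol (N := N) l x')))) = 0 := by
  obtain ⟨C, _, hbdd, hsum⟩ := Hcol_bdd_summable (N := N) (d := d)
  obtain ⟨CM, _, hMb, hMs⟩ := Mcol_bdd_summable (N := N) (d := d)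
  have h1 : ∀ x, |codiff₁ (Hcol (N := N) l' q) x| ≤ (d + 1 : ℕ) * (2 * C) := fun x => abs_codiff₁_le (hbdd l' q) x
  have h2 : ∀ κ x, |dz (codiff₁ (Hcol (N := N) l' q)) κ x| ≤ 2 * ((d + 1 : ℕ) * (2 * C)) := fun κ x => abs_dz_le h1 κ x
  have h3 : ∀ x, |codiff₁ (dz (codiff₁ (Hcol (N := N) l' q))) x| ≤ (d + 1 : ℕ) * (2 * (2 * ((d + 1 : ℕ) * (2 * C)))) :=
    fun x => abs_codiff₁_le h2 x
  have hdzM : ∀ κ, Summable (dz (Mcol (N := N) l x') κ) := fun κ => summable_dz (hMs l x') κ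
  rw [lip1_dz (hbdd l' q) (summable_codiff₁ hdzM), lip0_codiff₁ h1 hdzM, lip1_dz h2 (hMs l x')]
  exact tsum_mul_eq_zero_of_blockConst (N := N) h3 (isBlockConst_Hcol l' q) (hMs l x') (GamM_M (N := N) l x')

/-- … and the force term gives the column entry `ℋ_{(l',q)}(l, x') = wH l l' (x' − N q)`. [folklore] -/
theorem lip1_Hcol_δcol (l' l : Fin (d + 1)) (q x' : AffineAveraging.Site (d + 1)) :
    lip1 (Hcol (N := N) l' q) (δcol l x') = wH (N := N) l l' (x' - (N : ℤ) • q) := by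
  unfold lip1
  have e : ∀ x, ∑ μ, Hcol (N := N) l' q μ x * δcol l x' μ x = if x = x' then wH (N := N) l l' (x' - (N : ℤ) • q) else 0 := by
    intro x
    by_cases hx : x = x'
    · subst hx
      simp [δcol, Hcol]
    · simp [δcol, Hcol, hx]
  rw [tsum_congr e, tsum_eq_single x' (fun x hx => if_neg hx), if_pos rfl]

/-- Pairing the minimiser column's (EL) against a covariance column gives zero ((Q): `𝒬 Γ_b = 0`). [folklore] -/
theorem lip1_Gcol_curvAdj_curv_Hcol (l' l : Fin (d + 1)) (q x' : AffineAveraging.Site (d + 1)) :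
    lip1 (Gcol (N := N) l x') (curvAdj (curv (Hcol (N := N) l' q))) = 0 := by
  obtain ⟨C, _, hbdd, hsum⟩ := Gcol_bdd_summable (N := N) (d := d)
  obtain ⟨CΦ, _, hΦ⟩ := HΦcol_bdd (N := N) (d := d)
  rw [curvAdj_curv_Hcol, lip1_contourSumAdj (N := N) (hsum l x') (hΦ l' q)]
  refine (tsum_congr (fun y => ?_)).trans tsum_zero
  refine Finset.sum_eq_zero (fun κ _ => ?_)
  have hQ : contourSum N (Gcol (N := N) l x') κ y = 0 := Gam_Q (N := N) l x' κ y
  rw [hQ, mul_zero]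

/-- **ANTISYMMETRY OF THE OFF-DIAGONAL BLOCKS (`ℋ♭ = −ℋᵀ`)**: the constraint multiplier of the covariance column `Γ_b`,
`b = (l, x')`, at the coarse bond `(l', q)` is MINUS the minimiser column `ℋ_{(l', q)}` at `b`:
`GamΦ l' q l x' = − wH l l' (x' − N q)`.  (Green's second identity for `d*d` between the two columns; the two gauge
terms and the `𝒬ᵀ`-term against `Γ_b` drop by (G)/(M)/(Q).)  This is the sign carried by the typed KKT system, whose
(EL) row reads `d*d A = 𝒬ᵀ φ + dδd μ + F`. [folklore] -/
theorem GamΦ_eq_neg_wH (l' : Fin (d + 1)) (q : AffineAveraging.Site (d + 1)) (l : Fin (d + 1))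
    (x' : AffineAveraging.Site (d + 1)) :
    GamΦ (N := N) l' q l x' = -wH (N := N) l l' (x' - (N : ℤ) • q) := by
  obtain ⟨C, _, hbdd, hsum⟩ := Gcol_bdd_summable (N := N) (d := d)
  obtain ⟨CM, _, hMb, hMs⟩ := Mcol_bdd_summable (N := N) (d := d)
  obtain ⟨CΦ, _, hΦ⟩ := Φcol_bdd (N := N) (d := d)
  obtain ⟨CH, _, hHb, hHs⟩ := Hcol_bdd_summable (N := N) (d := d)
  -- Green pairing 1: ⟨ℋ, d*d Γ_b⟩ = GamΦ + wH
  have A1 : lip1 (Hcol (N := N) l' q) (curvAdj (curv (Gcol (N := N) l x')))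
      = lip2 (curv (Hcol (N := N) l' q)) (curv (Gcol (N := N) l x')) :=
    lip1_curvAdj (hHb l' q) (fun κ l₂ => summable_curv (hsum l x') κ l₂)
  have sT1 : ∀ μ, Summable (fun x => Hcol (N := N) l' q μ x * contourSumAdj N (Φcol (N := N) l x') μ x) := fun μ =>
    summable_mul_of_bdd' (hHs l' q μ) (fun x => abs_contourSumAdj_le (hΦ l x') μ x)
  have hT2b : ∀ μ x, |dz (codiff₁ (dz (Mcol (N := N) l x'))) μ x| ≤ 2 * ((d + 1 : ℕ) * (2 * (2 * CM))) := fun μ x =>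
    abs_dz_le (fun z => abs_codiff₁_le (fun κ w => abs_dz_le (hMb l x') κ w) z) μ x
  have sT2 : ∀ μ, Summable (fun x => Hcol (N := N) l' q μ x * dz (codiff₁ (dz (Mcol (N := N) l x'))) μ x) := fun μ =>
    summable_mul_of_bdd' (hHs l' q μ) (hT2b μ)
  have sδ : ∀ μ, Summable (fun x => Hcol (N := N) l' q μ x * δcol l x' μ x) := fun μ =>
    summable_mul_of_bdd' (M := 1) (hHs l' q μ) (fun x => by
      unfold δcol
      split_ifs <;> simp)
  have s12 : ∀ μ, Summable (fun x => Hcol (N := N) l' q μ x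
      * (contourSumAdj N (Φcol (N := N) l x') + dz (codiff₁ (dz (Mcol (N := N) l x')))) μ x) := fun μ => by
    have h := (sT1 μ).add (sT2 μ)
    simpa only [Pi.add_apply, mul_add] using h
  have A2 : lip1 (Hcol (N := N) l' q) (curvAdj (curv (Gcol (N := N) l x')))
      = GamΦ (N := N) l' q l x' + wH (N := N) l l' (x' - (N : ℤ) • q) := by
    rw [curvAdj_curv_Gcol, lip1_add s12 sδ, lip1_add sT1 sT2, lip1_Hcol_contourSumAdj, lip1_Hcol_gauge,
      lip1_Hcol_δcol, add_zero]
  -- Green pairing 2: ⟨Γ_b, d*d ℋ⟩ = 0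
  have B1 : lip1 (Gcol (N := N) l x') (curvAdj (curv (Hcol (N := N) l' q)))
      = lip2 (curv (Gcol (N := N) l x')) (curv (Hcol (N := N) l' q)) :=
    lip1_curvAdj (hbdd l x') (fun κ l₂ => summable_curv (hHs l' q) κ l₂)
  have B2 := lip1_Gcol_curvAdj_curv_Hcol (N := N) l' l q x'
  have h : GamΦ (N := N) l' q l x' + wH (N := N) l l' (x' - (N : ℤ) • q) = 0 := by
    rw [← A2, A1, lip2_comm, ← B1, B2]
  linarith

/-- The same statement in the coordinates of `KInv`'s coarse–fine block: for `x` on the coarse lattice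
(`Torus.proj N x = 0`, `x = N • quo N x`), `GamΦ l' (quo N x) l x' = − wH l l' (x' − x)`. [folklore] -/
theorem GamΦ_quo_eq_neg_wH {x : AffineAveraging.Site (d + 1)} (hx : Torus.proj N x = 0) (l' l : Fin (d + 1))
    (x' : AffineAveraging.Site (d + 1)) : GamΦ (N := N) l' (quo N x) l x' = -wH (N := N) l l' (x' - x) := by
  rw [GamΦ_eq_neg_wH, ← OneStepResolventKernel.eq_zsmul_quo_of_proj hx]

end Antisymmetry

/-! ## §3 The bottom level `N = 1` in closed form -/

section LevelOneGeneric

/-- `quo 1 = id`. [folklore] -/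
theorem quo_one (x : AffineAveraging.Site D) : quo 1 x = x := by
  funext j; simp [quo]

/-- The `1`-box is the single offset `0`. [folklore] -/
theorem box_one : box D 1 = {fun _ => 0} := by
  rw [box, Finset.range_one]
  exact Fintype.piFinset_singleton _

/-- The zero offset is the zero site. [folklore] -/
theorem toSite_zero : toSite (fun _ : Fin D => (0 : ℕ)) = 0 := by
  funext i; simp [toSite]

/-- `𝒬_1 = id`. [folklore] -/
theorem contourSum_one (A : Form1 D ℝ) : contourSum 1 A = A := by
  funext κ y
  simp [contourSum, box_one, toSite_zero]

/-- `𝒬ᵀ_1 = id`. [folklore] -/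
theorem contourSumAdj_one (φ : Form1 D ℝ) : contourSumAdj 1 φ = φ := by
  funext κ x
  simp [contourSumAdj_eq, quo_one]

/-- Every 0-form is `1`-block-constant. [folklore] -/
theorem isBlockConst_one (g : Form0 D ℝ) : IsBlockConst 1 g := by
  intro y b hb
  have hb0 : toSite b = 0 := by
    funext i
    have hi := Finset.mem_range.mp (Fintype.mem_piFinset.mp hb i)
    have : b i = 0 := by omega
    simp [toSite, this]
  rw [hb0, add_zero]

/-- `|d* F| ≤ 4 D M` for `|F| ≤ M`. [folklore] -/
theorem abs_curvAdj_le {F : Form2 D ℝ} {M : ℝ} (hF : ∀ κ l x, |F κ l x| ≤ M) (μ : Fin D) (y : AffineAveraging.Site D) :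
    |curvAdj F μ y| ≤ D * (2 * M) + D * (2 * M) := by
  simp only [curvAdj]
  have h1 : |∑ l : Fin D, (F μ l y - F μ l (y - unitVec l))| ≤ D * (2 * M) := by
    calc |∑ l : Fin D, (F μ l y - F μ l (y - unitVec l))| ≤ ∑ l : Fin D, |F μ l y - F μ l (y - unitVec l)| :=
          Finset.abs_sum_le_sum_abs _ _
      _ ≤ ∑ _l : Fin D, 2 * M := Finset.sum_le_sum fun l _ => by
          have h := abs_sub (F μ l y) (F μ l (y - unitVec l))
          linarith [hF μ l y, hF μ l (y - unitVec l)]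
      _ = D * (2 * M) := by simp
  have h2 : |∑ κ : Fin D, (F κ μ (y - unitVec κ) - F κ μ y)| ≤ D * (2 * M) := by
    calc |∑ κ : Fin D, (F κ μ (y - unitVec κ) - F κ μ y)| ≤ ∑ κ : Fin D, |F κ μ (y - unitVec κ) - F κ μ y| :=
          Finset.abs_sum_le_sum_abs _ _
      _ ≤ ∑ _κ : Fin D, 2 * M := Finset.sum_le_sum fun κ _ => by
          have h := abs_sub (F κ μ (y - unitVec κ)) (F κ μ y)
          linarith [hF κ μ (y - unitVec κ), hF κ μ y]
      _ = D * (2 * M) := by simp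
  exact (abs_add_le _ _).trans (add_le_add h1 h2)

end LevelOneGeneric

section LevelOne

variable {d : ℕ} [NeZero N]

/-- On the `1`-torus every point is `0`. [folklore] -/
theorem proj_eq_zero_of_eq_one (hN : N = 1) (x : AffineAveraging.Site (d + 1)) : Torus.proj N x = 0 := by
  subst hN
  haveI : Subsingleton (ZMod 1) := ZMod.subsingleton_iff.mpr rfl
  exact Subsingleton.elim _ _

/-- **`ℋ_1 = 𝟙`**: at blocking factor `1` the minimiser column with source `(l, 0)` is the unit form `δ_{(l,0)}` (uniqueness of
tempered KKT solutions against the explicit solution `(δ_{(l,0)}, d*d δ_{(l,0)}, 0)`). [folklore] -/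
theorem wH_one (hN : N = 1) (κ l : Fin (d + 1)) (z : AffineAveraging.Site (d + 1)) :
    wH (N := N) κ l z = if z = 0 ∧ κ = l then 1 else 0 := by
  subst hN
  have hAb : ∀ (κ : Fin (d + 1)) (z : AffineAveraging.Site (d + 1)), |(if z = 0 ∧ κ = l then (1 : ℝ) else 0)| ≤ 1 := by
    intro κ z; split_ifs <;> simp
  have hsol : SolvesKKT 1 0 (fun κ y => if y = 0 ∧ κ = l then 1 else 0)
      (fun κ z => if z = 0 ∧ κ = l then (1 : ℝ) else 0)
      (curvAdj (curv (fun κ z => if z = 0 ∧ κ = l then (1 : ℝ) else 0))) 0 :=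
    { el := fun κ x => by
        rw [contourSumAdj_one]
        simp [dz, codiff₁]
      gauge := isBlockConst_one _
      mean := fun y => by simp [blockSum]
      avg := fun κ y => by rw [contourSum_one] }
  have hφ : Tempered1 (curvAdj (curv (fun κ z => if z = 0 ∧ κ = l then (1 : ℝ) else 0))) :=
    Tempered1.of_bounded fun μ y => abs_curvAdj_le (fun κ l' x => abs_curv_le hAb κ l' x) μ y
  have h := (eq_wH_of_solvesKKT (N := 1) hsol (Tempered1.of_bounded hAb) hφ
    (Tempered0.of_bounded (B := 0) fun x => by simp)).1
  have hz := congr_fun (congr_fun h κ) z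
  exact hz.symm

/-- **`Γ_1 = 0`**: at blocking factor `1` the constraint `𝒬_1 A = A = 0` kills the fine field (uniqueness against the explicit
solution `(0, −δ_b, 0)`). [folklore] -/
theorem Gam_one (hN : N = 1) (κ : Fin (d + 1)) (x : AffineAveraging.Site (d + 1)) (l : Fin (d + 1))
    (x' : AffineAveraging.Site (d + 1)) : Gam (N := N) κ x l x' = 0 := by
  subst hN
  have hsol : SolvesKKT 1 (delta1 l x') 0 (0 : Form1 (d + 1) ℝ) (-(delta1 l x')) 0 :=
    { el := fun κ x => by
        rw [contourSumAdj_one]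
        simp [dz, codiff₁, curv, curvAdj]
      gauge := isBlockConst_one _
      mean := fun y => by simp [blockSum]
      avg := fun κ y => by rw [contourSum_one] }
  have h0 : Tempered1 (0 : Form1 (d + 1) ℝ) := Tempered1.of_bounded (B := 0) fun κ x => by simp
  have hφ : Tempered1 (-(delta1 l x')) := Tempered1.of_bounded (B := 1) fun κ x => by
    simp only [Pi.neg_apply, delta1_apply, abs_neg]
    split_ifs <;> simp
  have h := (eq_Gam_of_solvesKKT (N := 1) hsol h0 hφ (Tempered0.of_bounded (B := 0) fun x => by simp)).1
  have hz := congr_fun (congr_fun h κ) x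
  simpa using hz.symm

/-- The packed resolvent at `N = 1`: the field–field block vanishes. [folklore] -/
theorem KInv_inl_inl_of_eq_one (hN : N = 1) (x y : AffineAveraging.Site (d + 1)) (κ l : Fin (d + 1)) :
    KInv (N := N) x y (Sum.inl κ) (Sum.inl l) = 0 := by
  rw [OneStepResolventKernel.KInv_inl_inl]
  exact Gam_one hN κ x l y

/-- … the field–multiplier block is the identity. [folklore] -/
theorem KInv_inl_inr_of_eq_one (hN : N = 1) (x y : AffineAveraging.Site (d + 1)) (κ l : Fin (d + 1)) :
    KInv (N := N) x y (Sum.inl κ) (Sum.inr l) = if x = y ∧ κ = l then 1 else 0 := by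
  have h : KInv (N := N) x y (Sum.inl κ) (Sum.inr l) = if Torus.proj N y = 0 then wH (N := N) κ l (x - y) else 0 := rfl
  rw [h, if_pos (proj_eq_zero_of_eq_one hN y), wH_one hN]
  simp only [sub_eq_zero]

/-- … and the multiplier–field block is MINUS the identity (§2). [folklore] -/
theorem KInv_inr_inl_of_eq_one (hN : N = 1) (x y : AffineAveraging.Site (d + 1)) (κ l : Fin (d + 1)) :
    KInv (N := N) x y (Sum.inr κ) (Sum.inl l) = -(if y = x ∧ l = κ then 1 else 0) := by
  have h : KInv (N := N) x y (Sum.inr κ) (Sum.inl l)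
      = if Torus.proj N x = 0 then GamΦ (N := N) κ (quo N x) l y else 0 := rfl
  rw [h, if_pos (proj_eq_zero_of_eq_one hN x), GamΦ_quo_eq_neg_wH (proj_eq_zero_of_eq_one hN x), wH_one hN]
  simp only [sub_eq_zero]

/-- Left composition with `KInv (N := 1)` in a field slot READS the multiplier slot: `(𝕂₁ K)(inl κ, b) = K(inr κ, b)`. [folklore] -/
theorem comp_KInv_left_of_eq_one (hN : N = 1) (K : ExpKernelCalculus.MKer (d + 1) (OneStepResolventKernel.Fib d))
    (x z : AffineAveraging.Site (d + 1)) (κ : Fin (d + 1)) (b : OneStepResolventKernel.Fib d) :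
    ExpKernelCalculus.comp (KInv (N := N)) K x z (Sum.inl κ) b = K x z (Sum.inr κ) b := by
  unfold ExpKernelCalculus.comp
  have e : ∀ y, ∑ f, KInv (N := N) x y (Sum.inl κ) f * K y z f b = if y = x then K x z (Sum.inr κ) b else 0 := by
    intro y
    rw [Fintype.sum_sum_type]
    simp only [KInv_inl_inl_of_eq_one hN, zero_mul, Finset.sum_const_zero, zero_add, KInv_inl_inr_of_eq_one hN]
    by_cases hy : y = x
    · subst hy
      simp [ite_mul, Finset.sum_ite_eq]
    · simp [hy, Ne.symm hy]
  rw [tsum_congr e, tsum_eq_single x (fun y hy => if_neg hy), if_pos rfl]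

/-- Right composition with `KInv (N := 1)` into a field slot READS MINUS the multiplier slot: `(K 𝕂₁)(a, inl l) = −K(a, inr l)`.
[folklore] -/
theorem comp_KInv_right_of_eq_one (hN : N = 1) (K : ExpKernelCalculus.MKer (d + 1) (OneStepResolventKernel.Fib d))
    (x z : AffineAveraging.Site (d + 1)) (a : OneStepResolventKernel.Fib d) (l : Fin (d + 1)) :
    ExpKernelCalculus.comp K (KInv (N := N)) x z a (Sum.inl l) = -K x z a (Sum.inr l) := by
  unfold ExpKernelCalculus.comp
  have e : ∀ y, ∑ f, K x y a f * KInv (N := N) y z f (Sum.inl l) = if y = z then -K x z a (Sum.inr l) else 0 := by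
    intro y
    rw [Fintype.sum_sum_type]
    simp only [KInv_inl_inl_of_eq_one hN, mul_zero, Finset.sum_const_zero, zero_add, KInv_inr_inl_of_eq_one hN]
    by_cases hy : y = z
    · subst hy
      simp [mul_ite]
    · simp [hy, Ne.symm hy]
  rw [tsum_congr e, tsum_eq_single z (fun y hy => if_neg hy), if_pos rfl]

/-- The inter-level lift at `M = 1` is the plain re-slotting. [folklore] -/
theorem lift_one (s t : Bool) (K : ExpKernelCalculus.MKer (d + 1) (OneStepResolventKernel.Fib d))
    (x y : AffineAveraging.Site (d + 1)) (κ l : Fin (d + 1)) :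
    InterLevelTransport.lift 1 s t K x y (Sum.inr κ) (Sum.inr l)
      = K x y (InterLevelTransport.slot s κ) (InterLevelTransport.slot t l) := by
  have hx := proj_eq_zero_of_eq_one (N := 1) (d := d) rfl x
  have hy := proj_eq_zero_of_eq_one (N := 1) (d := d) rfl y
  simp only [InterLevelTransport.lift, hx, hy, and_self, if_true, quo_one]

/-- The weighted lift at `M = 1` is the plain re-slotting (both slot factors are `1`). [folklore] -/
theorem liftW_one (s t : Bool) (K : ExpKernelCalculus.MKer (d + 1) (OneStepResolventKernel.Fib d))
    (x y : AffineAveraging.Site (d + 1)) (κ l : Fin (d + 1)) :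
    InterLevelTransport.liftW 1 s t K x y (Sum.inr κ) (Sum.inr l)
      = K x y (InterLevelTransport.slot s κ) (InterLevelTransport.slot t l) := by
  simp only [InterLevelTransport.liftW, InterLevelTransport.slotW, Nat.cast_one, one_pow, ite_self, one_mul, lift_one]

/-- The field slot. [folklore] -/
@[simp] theorem slot_true (κ : Fin (d + 1)) : InterLevelTransport.slot (d := d) true κ = Sum.inl κ := rfl
/-- The multiplier slot. [folklore] -/
@[simp] theorem slot_false (κ : Fin (d + 1)) : InterLevelTransport.slot (d := d) false κ = Sum.inr κ := rfl

/-- `dec 1 = id` (same statement as the pending `HessianTelescopingKKT.dec_one` of the telescoping node; three lines, re-proved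
here to keep this leaf's imports minimal). [folklore] -/
theorem dec_one' (K : ExpKernelCalculus.MKer (d + 1) (OneStepResolventKernel.Fib d)) : OneStepKernelFamily.dec 1 K = K := by
  funext x y a b
  have hS : ∀ c : OneStepResolventKernel.Fib d, OneStepKernelFamily.legSet d 1 c = {(fun _ => 0, 0)} := fun c => by
    cases c with
    | inl κ =>
        simp only [OneStepKernelFamily.legSet, OneStepKernelFamily.LegIdx, Finset.range_one, Fintype.piFinset_singleton,
          Finset.singleton_product_singleton]
    | inr _ => rfl
  have hW : ∀ c : OneStepResolventKernel.Fib d, OneStepKernelFamily.legW d 1 c = 1 := fun c => by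
    cases c <;> simp [OneStepKernelFamily.legW]
  have hP : ∀ (c : OneStepResolventKernel.Fib d) (u : Fin (d + 1) → ℤ), OneStepKernelFamily.legPt 1 c u (fun _ => 0, 0) = u :=
    fun c u => by
      cases c with
      | inl κ => funext i; simp [OneStepKernelFamily.legPt]
      | inr _ => simp [OneStepKernelFamily.legPt]
  simp only [OneStepKernelFamily.dec, hS, Finset.sum_singleton, hW, one_mul, hP]

/-- `KInvStep L 0 = KInv (N := L ^ (0 + 1))` (the step-`0` decimation is by the factor `L^0 = 1`). [folklore] -/
theorem kInvStep_zero' (Lc : ℕ) [NeZero Lc] :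
    OneStepKernelFamily.KInvStep (d := d) Lc 0 = KInv (N := Lc ^ (0 + 1)) (d := d) := by
  unfold OneStepKernelFamily.KInvStep
  rw [pow_zero, dec_one']

end LevelOne

/-! ## §4 The composition predicates of the interface (verbatim) and their decision at `j = 0` -/

section Interface

open ExpKernelCalculus (comp)
open OneStepKernelFamily (KInvStep colH)
open InterLevelTransport (liftW)

variable {d : ℕ} (Lc : ℕ) [NeZero Lc]

/-- (K1a′) — VERBATIM COPY of the interface owner's display (`ResolventComposition.sketch.v1`, journal REQUEST (K1′)):
«composition of fluctuation covariances at kernel level, unit-corrected».  A PREDICATE; its DECISION at `j = 0` is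
`k1a'_zero_iff` below (it says `Γ_{L} ≡ 0`); for `j ≥ 1` it is false numerically in two independent ways (the sign of the
composite term, §2, and the gauge-slice defect — `NUMERICS.md` of the node, non-load-bearing). [folklore] -/
def K1a' (j : ℕ) : Prop :=
  ∀ (x y : Fin (d + 1) → ℤ) (κ l : Fin (d + 1)),
    KInv (N := Lc ^ (j + 1)) (d := d) x y (Sum.inl κ) (Sum.inl l) =
      KInv (N := Lc ^ j) (d := d) x y (Sum.inl κ) (Sum.inl l) +
        comp (KInv (N := Lc ^ j) (d := d))
          (comp (liftW (Lc ^ j) true true (KInvStep (d := d) Lc j)) (KInv (N := Lc ^ j) (d := d)))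
          x y (Sum.inl κ) (Sum.inl l)

/-- (K1b′) — VERBATIM COPY: «composition of minimisers at kernel level, unit-corrected».  A PREDICATE; TRUE at `j = 0`
(`k1b'_zero`) and AT EVERY `j` (`k1b'`, §6). [folklore] -/
def K1b' (j : ℕ) : Prop :=
  ∀ (x z : Fin (d + 1) → ℤ) (κ μ : Fin (d + 1)),
    colH (KInv (N := Lc ^ (j + 1)) (d := d)) (Lc ^ (j + 1)) μ z κ x =
      comp (KInv (N := Lc ^ j) (d := d)) (liftW (Lc ^ j) true false (KInvStep (d := d) Lc j))
        x (((Lc ^ (j + 1) : ℕ) : ℤ) • z) (Sum.inl κ) (Sum.inr μ)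

/-- (K1c′) — VERBATIM COPY: «composition of left companions at kernel level, unit-corrected».  A PREDICATE; FALSE at `j = 0`
(`not_k1c'_zero`: it says `ℋ_{L} ≡ 0`) and AT EVERY `j` (`not_k1c'`, §5) — the sign is wrong (§2, `ℋ♭ = −ℋᵀ`); the corrected
form is `K1cNeg`. [folklore] -/
def K1c' (j : ℕ) : Prop :=
  ∀ (z y : Fin (d + 1) → ℤ) (μ l : Fin (d + 1)),
    KInv (N := Lc ^ (j + 1)) (d := d) (((Lc ^ (j + 1) : ℕ) : ℤ) • z) y (Sum.inr μ) (Sum.inl l) =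
      comp (liftW (Lc ^ j) false true (KInvStep (d := d) Lc j)) (KInv (N := Lc ^ j) (d := d))
        (((Lc ^ (j + 1) : ℕ) : ℤ) • z) y (Sum.inr μ) (Sum.inl l)

/-- THE INTERFACE BUNDLE — VERBATIM COPY (the three predicates for every `j ≥ 1`).  CONSUMED here by `KKTComposable.minOp_one`;
FALSE AS TYPED for every `L`, `d` (`not_kktComposable`, §5: its `minOpL 1` is `K1c' L 1`); its `minOp` field holds
unconditionally (`k1b'`, §6); its `flucCov` field is false by the evidence recorded at `K1a'`. [folklore] -/
structure KKTComposable : Prop where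
  /-- (K1a′) for all `j ≥ 1`. -/
  flucCov : ∀ j : ℕ, 1 ≤ j → K1a' (d := d) Lc j
  /-- (K1b′) for all `j ≥ 1`. -/
  minOp : ∀ j : ℕ, 1 ≤ j → K1b' (d := d) Lc j
  /-- (K1c′) for all `j ≥ 1`. -/
  minOpL : ∀ j : ℕ, 1 ≤ j → K1c' (d := d) Lc j

/-- Reading a field of the bundle (its only use in this file). [folklore] -/
theorem KKTComposable.minOp_one (h : KKTComposable (d := d) Lc) : K1b' (d := d) Lc 1 := h.minOp 1 le_rfl

/-- (K1c⁻) THE SIGN-CORRECTED LEFT-COMPANION IDENTITY: as (K1c′) with a MINUS sign on the composite (`ℋ♭ = −ℋᵀ`, §2).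
TRUE at `j = 0` (`k1cNeg_zero`) and AT EVERY `j` (`k1cNeg`, §6). [folklore] -/
def K1cNeg (j : ℕ) : Prop :=
  ∀ (z y : Fin (d + 1) → ℤ) (μ l : Fin (d + 1)),
    KInv (N := Lc ^ (j + 1)) (d := d) (((Lc ^ (j + 1) : ℕ) : ℤ) • z) y (Sum.inr μ) (Sum.inl l) =
      -comp (liftW (Lc ^ j) false true (KInvStep (d := d) Lc j)) (KInv (N := Lc ^ j) (d := d))
        (((Lc ^ (j + 1) : ℕ) : ℤ) • z) y (Sum.inr μ) (Sum.inl l)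

/-- (K1a⁻) THE SIGN-CORRECTED ONE-SLICE COVARIANCE TELESCOPING: as (K1a′) with a MINUS sign on the composite.  TRUE at `j = 0`
(`k1aNeg_zero`, where it is the tautology `Γ_L = 0 − (−Γ_L)`); for `j ≥ 1` it is FALSE ENTRYWISE numerically (gauge-slice defect:
the weak-Landau slice `{δdδA ∈ BC_N}` depends on `N` and a covariance column of level `L^(j+1)` has a non-zero gauge multiplier
outside the level-`L^j` multiplier space) — recorded as the natural but wrong statement; the true replacement is `K1aTrans`.
[folklore] -/
def K1aNeg (j : ℕ) : Prop :=
  ∀ (x y : Fin (d + 1) → ℤ) (κ l : Fin (d + 1)),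
    KInv (N := Lc ^ (j + 1)) (d := d) x y (Sum.inl κ) (Sum.inl l) =
      KInv (N := Lc ^ j) (d := d) x y (Sum.inl κ) (Sum.inl l) -
        comp (KInv (N := Lc ^ j) (d := d))
          (comp (liftW (Lc ^ j) true true (KInvStep (d := d) Lc j)) (KInv (N := Lc ^ j) (d := d)))
          x y (Sum.inl κ) (Sum.inl l)

/-- (K1aᵀ) THE TRANSVERSE COVARIANCE TELESCOPING: (K1a⁻) PAIRED ON BOTH FIELD LEGS WITH FINITELY SUPPORTED CO-CLOSED TEST
1-FORMS (`codiff₁ F = 0 = codiff₁ F'`).  TRUE at `j = 0` (`k1aTrans_zero`) and PROVED FOR EVERY `j` in the companion leaf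
`Beta/ResolventCompositionStepB` (`k1aTrans`; numerics exact to `1e-13`, while generic — not co-closed — test forms fail at
`5e-1`): for co-closed forces the gauge multiplier of the level-`L^(j+1)` covariance field vanishes (`McolSum_eq_zero`, §7)
and the field decomposes over the two levels (`GcolSum_decomposition`, §7). [folklore] -/
def K1aTrans (j : ℕ) : Prop :=
  ∀ (F F' : Form1 (d + 1) ℝ), (∀ κ, (Function.support (F κ)).Finite) → (∀ κ, (Function.support (F' κ)).Finite) →
    codiff₁ F = 0 → codiff₁ F' = 0 →
      (∑' x : (Fin (d + 1) → ℤ), ∑' y : (Fin (d + 1) → ℤ), ∑ κ : Fin (d + 1), ∑ l : Fin (d + 1),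
          F κ x * KInv (N := Lc ^ (j + 1)) (d := d) x y (Sum.inl κ) (Sum.inl l) * F' l y)
        = ∑' x : (Fin (d + 1) → ℤ), ∑' y : (Fin (d + 1) → ℤ), ∑ κ : Fin (d + 1), ∑ l : Fin (d + 1),
          F κ x * (KInv (N := Lc ^ j) (d := d) x y (Sum.inl κ) (Sum.inl l) -
            comp (KInv (N := Lc ^ j) (d := d))
              (comp (liftW (Lc ^ j) true true (KInvStep (d := d) Lc j)) (KInv (N := Lc ^ j) (d := d)))
              x y (Sum.inl κ) (Sum.inl l)) * F' l y

/-- The composite term of (K1b′) at `j = 0` READS the step kernel: `(𝕂₁ ∘ liftW 1 true false 𝔄₀)(x, L z; inl κ, inr μ)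
= 𝔄₀(x, L z; inl κ, inr μ) = KInv_L (x, L z; inl κ, inr μ)`. [folklore] -/
theorem compB_zero (x z : Fin (d + 1) → ℤ) (κ μ : Fin (d + 1)) :
    comp (KInv (N := Lc ^ 0) (d := d)) (liftW (Lc ^ 0) true false (KInvStep (d := d) Lc 0))
        x (((Lc ^ (0 + 1) : ℕ) : ℤ) • z) (Sum.inl κ) (Sum.inr μ)
      = KInv (N := Lc ^ (0 + 1)) (d := d) x (((Lc ^ (0 + 1) : ℕ) : ℤ) • z) (Sum.inl κ) (Sum.inr μ) := by
  rw [comp_KInv_left_of_eq_one (pow_zero Lc), pow_zero, liftW_one, slot_true, slot_false, kInvStep_zero']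

/-- The composite term of (K1c′) at `j = 0` READS MINUS the coarse–fine block. [folklore] -/
theorem compC_zero (z y : Fin (d + 1) → ℤ) (μ l : Fin (d + 1)) :
    comp (liftW (Lc ^ 0) false true (KInvStep (d := d) Lc 0)) (KInv (N := Lc ^ 0) (d := d))
        (((Lc ^ (0 + 1) : ℕ) : ℤ) • z) y (Sum.inr μ) (Sum.inl l)
      = -KInv (N := Lc ^ (0 + 1)) (d := d) (((Lc ^ (0 + 1) : ℕ) : ℤ) • z) y (Sum.inr μ) (Sum.inl l) := by
  rw [comp_KInv_right_of_eq_one (pow_zero Lc), pow_zero, liftW_one, slot_true, slot_false, kInvStep_zero']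

/-- The composite term of (K1a′) at `j = 0` READS MINUS the field–field block. [folklore] -/
theorem compA_zero (x y : Fin (d + 1) → ℤ) (κ l : Fin (d + 1)) :
    comp (KInv (N := Lc ^ 0) (d := d))
        (comp (liftW (Lc ^ 0) true true (KInvStep (d := d) Lc 0)) (KInv (N := Lc ^ 0) (d := d)))
        x y (Sum.inl κ) (Sum.inl l)
      = -KInv (N := Lc ^ (0 + 1)) (d := d) x y (Sum.inl κ) (Sum.inl l) := by
  rw [comp_KInv_left_of_eq_one (pow_zero Lc), comp_KInv_right_of_eq_one (pow_zero Lc), pow_zero, liftW_one, slot_true,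
    slot_true, kInvStep_zero']

/-- **(K1b′) HOLDS AT `j = 0`.** [folklore] -/
theorem k1b'_zero : K1b' (d := d) Lc 0 := by
  intro x z κ μ
  rw [compB_zero]
  rfl

/-- **(K1c⁻) HOLDS AT `j = 0`.** [folklore] -/
theorem k1cNeg_zero : K1cNeg (d := d) Lc 0 := by
  intro z y μ l
  rw [compC_zero, neg_neg]

/-- **(K1a⁻) HOLDS AT `j = 0`** (as the tautology `Γ_L = 0 − (−Γ_L)`). [folklore] -/
theorem k1aNeg_zero : K1aNeg (d := d) Lc 0 := by
  intro x y κ l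
  rw [compA_zero, KInv_inl_inl_of_eq_one (pow_zero Lc)]
  ring

/-- **(K1aᵀ) HOLDS AT `j = 0`** (entrywise, from `k1aNeg_zero`; the hypotheses are not used at the bottom level). [folklore] -/
theorem k1aTrans_zero : K1aTrans (d := d) Lc 0 := by
  intro F F' _ _ _ _
  refine tsum_congr fun x => tsum_congr fun y => Finset.sum_congr rfl fun κ _ => Finset.sum_congr rfl fun l _ => ?_
  rw [k1aNeg_zero Lc x y κ l]

/-- **(K1c′) AT `j = 0` SAYS `ℋ_L ≡ 0`.** [folklore] -/
theorem k1c'_zero_iff : K1c' (d := d) Lc 0 ↔ ∀ (κ l : Fin (d + 1)) (u : Fin (d + 1) → ℤ), wH (N := Lc ^ (0 + 1)) κ l u = 0 := by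
  have key : ∀ (z y : Fin (d + 1) → ℤ) (μ l : Fin (d + 1)),
      (KInv (N := Lc ^ (0 + 1)) (d := d) (((Lc ^ (0 + 1) : ℕ) : ℤ) • z) y (Sum.inr μ) (Sum.inl l) =
        comp (liftW (Lc ^ 0) false true (KInvStep (d := d) Lc 0)) (KInv (N := Lc ^ 0) (d := d))
          (((Lc ^ (0 + 1) : ℕ) : ℤ) • z) y (Sum.inr μ) (Sum.inl l))
      ↔ wH (N := Lc ^ (0 + 1)) l μ (y - ((Lc ^ (0 + 1) : ℕ) : ℤ) • z) = 0 := by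
    intro z y μ l
    rw [compC_zero, KInv_inr_inl_coarse, GamΦ_eq_neg_wH]
    constructor
    · intro h; linarith
    · intro h; rw [h]; simp
  constructor
  · intro h κ l u
    have h1 := (key 0 u l κ).1 (h 0 u l κ)
    simpa using h1
  · intro h z y μ l
    exact (key z y μ l).2 (h l μ _)

/-- **(K1c′) IS FALSE AT `j = 0`** (for every blocking factor `L ≥ 1` and every dimension): `ℋ_L` has unit contour sums
(`KernelSpecInstance.wH_Q`), so it is not identically zero. [folklore] -/
theorem not_k1c'_zero : ¬ K1c' (d := d) Lc 0 := by
  intro h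
  have h0 := (k1c'_zero_iff Lc).1 h
  have hQ := wH_Q (N := Lc ^ (0 + 1)) (d := d) (0 : Fin (d + 1)) 0 0
  have hz : (fun κ z => wH (N := Lc ^ (0 + 1)) (d := d) κ (0 : Fin (d + 1)) z) = fun _ _ => 0 := by
    funext κ z; exact h0 κ 0 z
  rw [hz] at hQ
  simp [contourSum] at hQ

/-- **(K1a′) AT `j = 0` SAYS `Γ_L ≡ 0`** (the covariance of the first fluctuation step vanishes identically — absurd as soon as
one entry of `Gam (N := L)` is non-zero, which is the case for `L ≥ 2`, `d ≥ 1`; the non-vanishing witness is not formalised in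
this version). [folklore] -/
theorem k1a'_zero_iff :
    K1a' (d := d) Lc 0 ↔ ∀ (κ l : Fin (d + 1)) (x y : Fin (d + 1) → ℤ), Gam (N := Lc ^ (0 + 1)) κ x l y = 0 := by
  have key : ∀ (x y : Fin (d + 1) → ℤ) (κ l : Fin (d + 1)),
      (KInv (N := Lc ^ (0 + 1)) (d := d) x y (Sum.inl κ) (Sum.inl l) =
        KInv (N := Lc ^ 0) (d := d) x y (Sum.inl κ) (Sum.inl l) +
          comp (KInv (N := Lc ^ 0) (d := d))
            (comp (liftW (Lc ^ 0) true true (KInvStep (d := d) Lc 0)) (KInv (N := Lc ^ 0) (d := d)))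
            x y (Sum.inl κ) (Sum.inl l))
      ↔ Gam (N := Lc ^ (0 + 1)) κ x l y = 0 := by
    intro x y κ l
    rw [compA_zero, KInv_inl_inl_of_eq_one (pow_zero Lc), KInv_inl_inl]
    constructor
    · intro h; linarith
    · intro h; rw [h]; ring
  constructor
  · intro h κ l x y
    exact (key x y κ l).1 (h x y κ l)
  · intro h x y κ l
    exact (key x y κ l).2 (h κ l x y)

/-- Hence (K1a′) at `j = 0` is refuted by any single non-zero covariance entry. [folklore] -/
theorem not_k1a'_zero_of_ne {κ l : Fin (d + 1)} {x y : Fin (d + 1) → ℤ} (h : Gam (N := Lc ^ (0 + 1)) κ x l y ≠ 0) :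
    ¬ K1a' (d := d) Lc 0 :=
  fun hK => h ((k1a'_zero_iff Lc).1 hK κ l x y)

end Interface

/-! ## §5 The interface bundle is false as typed, at EVERY step: a finite contour-sum count (v1.1) -/

section Refutation

open ExpKernelCalculus (comp Decays)
open OneStepKernelFamily (KInvStep colH dec legSet legW legPt LegIdx decays_KInvStep)
open InterLevelTransport (liftW slotW slotW_true slotW_false liftW_zsmul liftW_off liftW_inl_right tsum_sublattice)
open StepDriftWitness (contourSum_compose sum_LegIdx_eq_contourSum)

variable {d : ℕ} (Lc : ℕ) [NeZero Lc]

/-- `𝒬` of a negated form. [folklore] -/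
theorem contourSum_neg' {L : ℕ} (A : Form1 D ℝ) (κ : Fin D) (y : AffineAveraging.Site D) :
    contourSum L (fun κ x => -A κ x) κ y = -contourSum L A κ y := by
  simp only [contourSum, Finset.sum_neg_distrib]

/-- `𝒬` of a scaled form. [folklore] -/
theorem contourSum_const_mul {L : ℕ} (c : ℝ) (A : Form1 D ℝ) (κ : Fin D) (y : AffineAveraging.Site D) :
    contourSum L (fun κ x => c * A κ x) κ y = c * contourSum L A κ y := by
  simp only [contourSum, Finset.mul_sum]

/-- `𝒬` of a finite sum of forms. [folklore] -/
theorem contourSum_finset_sum {L : ℕ} {ι : Type*} (s : Finset ι) (A : ι → Form1 D ℝ) (κ : Fin D)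
    (y : AffineAveraging.Site D) :
    contourSum L (fun κ x => ∑ i ∈ s, A i κ x) κ y = ∑ i ∈ s, contourSum L (A i) κ y := by
  simp only [contourSum]
  calc ∑ b ∈ box D L, ∑ t ∈ Finset.range L, ∑ i ∈ s, A i κ ((L : ℤ) • y + toSite b + (t : ℤ) • unitVec κ)
      = ∑ b ∈ box D L, ∑ i ∈ s, ∑ t ∈ Finset.range L, A i κ ((L : ℤ) • y + toSite b + (t : ℤ) • unitVec κ) :=
        Finset.sum_congr rfl fun b _ => Finset.sum_comm
    _ = ∑ i ∈ s, ∑ b ∈ box D L, ∑ t ∈ Finset.range L, A i κ ((L : ℤ) • y + toSite b + (t : ℤ) • unitVec κ) :=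
        Finset.sum_comm

/-- `𝒬` through an absolutely convergent series of forms. [folklore] -/
theorem contourSum_tsum {L : ℕ} {ι : Type*} (f : ι → Form1 D ℝ) (hf : ∀ κ x, Summable fun i => f i κ x) (κ : Fin D)
    (y : AffineAveraging.Site D) :
    contourSum L (fun κ x => ∑' i, f i κ x) κ y = ∑' i, contourSum L (f i) κ y := by
  simp only [contourSum]
  rw [Summable.tsum_finsetSum (fun b _ => summable_sum fun s _ => hf κ _)]
  refine Finset.sum_congr rfl fun b _ => ?_
  rw [Summable.tsum_finsetSum (fun s _ => hf κ _)]

/-- SUBLATTICE RE-INDEXING in the shape used below: a fine sum of a function vanishing off `M•ℤ^{d+1}` is the coarse sum of its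
values on the sublattice (`InterLevelTransport.tsum_sublattice` with offset `0`). [folklore] -/
theorem tsum_sublattice₀ (M : ℕ) [NeZero M] (F G : (Fin (d + 1) → ℤ) → ℝ) (hoff : ∀ w, Torus.proj M w ≠ 0 → F w = 0)
    (hon : ∀ w', F ((M : ℤ) • w') = G w') : ∑' w, F w = ∑' w', G w' := by
  have e : ∀ w, F w = if Torus.proj M (w - 0) = 0 then G (quo M (w - 0)) else 0 := by
    intro w
    rw [sub_zero]
    by_cases h : Torus.proj M w = 0
    · rw [if_pos h, ← hon, ← OneStepResolventKernel.eq_zsmul_quo_of_proj h]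
    · rw [if_neg h, hoff w h]
  rw [tsum_congr e]
  exact tsum_sublattice M 0 G

/-- The weighted lift read at the coarse origin and a sublattice point. [folklore] -/
theorem liftW_zero_zsmul (M : ℕ) [NeZero M] (s t : Bool) (K : ExpKernelCalculus.MKer (d + 1) (Fib d))
    (w' : Fin (d + 1) → ℤ) (κ l : Fin (d + 1)) :
    liftW M s t K 0 ((M : ℤ) • w') (Sum.inr κ) (Sum.inr l)
      = slotW d M s * slotW d M t * K 0 w' (InterLevelTransport.slot s κ) (InterLevelTransport.slot t l) := by
  have h := liftW_zsmul M s t K 0 w' κ l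
  rwa [smul_zero] at h

/-- The entries of the decimated composite resolvent are uniformly bounded. [folklore] -/
theorem exists_abs_KInvStep_le (j : ℕ) : ∃ B : ℝ, ∀ x y a b, |KInvStep (d := d) Lc j x y a b| ≤ B := by
  obtain ⟨δ, C, hδ, hC, h⟩ := decays_KInvStep (Lc := Lc) (d := d) j
  refine ⟨C, fun x y a b => (h x y a b).trans ?_⟩
  have h0 : 0 ≤ l1 (x - y) := l1_nonneg _
  have h1 : Real.exp (-δ * l1 (x - y)) ≤ 1 := Real.exp_le_one_iff.mpr (by nlinarith)
  exact mul_le_of_le_one_right hC h1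

/-- A translated, dilated minimiser column is summable in the coarse variable. [folklore] -/
theorem summable_wH_sub_zsmul (M : ℕ) [NeZero M] (κ l : Fin (d + 1)) (x : Fin (d + 1) → ℤ) :
    Summable fun w' : Fin (d + 1) → ℤ => wH (N := M) (d := d) κ l (x - (M : ℤ) • w') := by
  obtain ⟨δ, C, hδ, h⟩ := decay_wH (N := M) (d := d)
  have hs : Summable (wH (N := M) (d := d) κ l) := summable_of_decay510 hδ (h κ l)
  have hi : Function.Injective fun w' : Fin (d + 1) → ℤ => x - (M : ℤ) • w' := by
    intro a b hab
    have h1 : (M : ℤ) • a = (M : ℤ) • b := sub_right_injective hab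
    have h2 := congrArg (quo M) h1
    simpa only [OneStepResolventKernel.quo_zsmul] using h2
  exact hs.comp_injective hi

/-- The (multiplier, field) entries of a decimated kernel: the multiplier leg is read at the coarse point, the field leg is the
`M`-block-contour average (mirror of `StepDriftWitness.dec_inl_inr`). [folklore] -/
theorem dec_inr_inl (M : ℕ) (K : ExpKernelCalculus.MKer (d + 1) (Fib d)) (μ l : Fin (d + 1)) (x' y' : Fin (d + 1) → ℤ) :
    dec M K x' y' (Sum.inr μ) (Sum.inl l)
      = ((M : ℝ) ^ (d + 2))⁻¹ * ∑ i ∈ LegIdx d M, K ((M : ℤ) • x') (legPt M (Sum.inl l) y' i) (Sum.inr μ) (Sum.inl l) := by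
  simp only [dec, legSet, legW, Finset.sum_singleton, one_mul, Finset.mul_sum]
  rfl

/-- **THE `ℋ♭`-ENTRIES OF THE DECIMATED COMPOSITE RESOLVENT** at the coarse origin: MINUS the `L^j`-block-contour average of
the composite minimiser at blocking `L^(j+1)` (`ℋ♭ = −ℋᵀ`, §2). [folklore] -/
theorem KInvStep_inr_inl_zero (j : ℕ) (μ l : Fin (d + 1)) (w' : Fin (d + 1) → ℤ) :
    KInvStep (d := d) Lc j 0 w' (Sum.inr μ) (Sum.inl l)
      = -((((Lc ^ j : ℕ) : ℝ) ^ (d + 2))⁻¹ * contourSum (Lc ^ j) (fun κ' z => wH (N := Lc ^ (j + 1)) κ' μ z) l w') := by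
  unfold KInvStep
  rw [dec_inr_inl, smul_zero, ← sum_LegIdx_eq_contourSum, ← mul_neg, ← Finset.sum_neg_distrib]
  congr 1
  refine Finset.sum_congr rfl fun i _ => ?_
  have h := KInv_inr_inl_coarse (N := Lc ^ (j + 1)) μ l 0 (legPt (Lc ^ j) (Sum.inl l) w' i)
  rw [smul_zero] at h
  rw [h, GamΦ_eq_neg_wH, smul_zero, sub_zero]

/-- **THE `ℋ♭`-BLOCK AVERAGES TO MINUS THE IDENTITY**: summed over the `L`-block contour of the step-`j` lattice at the origin,
the `(inr μ, inl μ)` entries of `KInvStep L j` give `−(L^j)^{−(d+2)}` (composition of block-contour sums,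
`StepDriftWitness.contourSum_compose`, and `𝒬ℋ = 1` at blocking `L^(j+1)`). [folklore] -/
theorem sum_KInvStep_inr_inl (j : ℕ) (μ : Fin (d + 1)) :
    ∑ b' ∈ box (d + 1) Lc, ∑ s' ∈ Finset.range Lc,
        KInvStep (d := d) Lc j 0 (toSite b' + (s' : ℤ) • unitVec μ) (Sum.inr μ) (Sum.inl μ)
      = -((((Lc ^ j : ℕ) : ℝ) ^ (d + 2))⁻¹) := by
  simp only [KInvStep_inr_inl_zero, Finset.sum_neg_distrib, ← Finset.mul_sum]
  have hM : 0 < Lc ^ j := pow_pos (Nat.pos_of_ne_zero (NeZero.ne Lc)) j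
  rw [contourSum_compose (Lc ^ j) Lc hM (fun κ' z => wH (N := Lc ^ (j + 1)) κ' μ z) μ, ← pow_succ, wH_Q]
  simp

/-- **THE COMPOSITE OF (K1c′) AT THE COARSE ORIGIN IS A SUPERPOSITION OF LEVEL-`L^j` MINIMISER COLUMNS** with the
coefficients `−(L^j)^(d+2) · KInvStep L j (0, w′; inr μ, inl l″)` (sublattice re-indexing, `liftW` pins, `ℋ♭ = −ℋᵀ`).
[folklore] -/
theorem compC_apply (j : ℕ) (μ l₂ : Fin (d + 1)) (y : Fin (d + 1) → ℤ) :
    comp (liftW (Lc ^ j) false true (KInvStep (d := d) Lc j)) (KInv (N := Lc ^ j) (d := d))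
        0 y (Sum.inr μ) (Sum.inl l₂)
      = ∑' w' : (Fin (d + 1) → ℤ), -((((Lc ^ j : ℕ) : ℝ) ^ (d + 2)) *
          ∑ l'' : Fin (d + 1), KInvStep (d := d) Lc j 0 w' (Sum.inr μ) (Sum.inl l'') *
            wH (N := Lc ^ j) (d := d) l₂ l'' (y - ((Lc ^ j : ℕ) : ℤ) • w')) := by
  unfold ExpKernelCalculus.comp
  refine tsum_sublattice₀ (Lc ^ j) _ _ (fun w hw => ?_) (fun w' => ?_)
  · simp only [liftW_off (Lc ^ j) false true _ (Or.inr hw), zero_mul, Finset.sum_const_zero]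
  · rw [Fintype.sum_sum_type]
    simp only [liftW_inl_right, zero_mul, Finset.sum_const_zero, zero_add, liftW_zero_zsmul, KInv_inr_inl_coarse,
      GamΦ_eq_neg_wH, slotW_true, slotW_false, one_mul, slot_true, slot_false, mul_neg, Finset.sum_neg_distrib,
      Finset.mul_sum, mul_assoc]

/-- Summability of the superposition coefficients against a translated column. [folklore] -/
theorem summable_compC_term (j : ℕ) (μ κ : Fin (d + 1)) (x : Fin (d + 1) → ℤ) :
    Summable fun w' : Fin (d + 1) → ℤ => -((((Lc ^ j : ℕ) : ℝ) ^ (d + 2)) *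
      ∑ l'' : Fin (d + 1), KInvStep (d := d) Lc j 0 w' (Sum.inr μ) (Sum.inl l'') *
        wH (N := Lc ^ j) (d := d) κ l'' (x - ((Lc ^ j : ℕ) : ℤ) • w')) := by
  obtain ⟨B, hB⟩ := exists_abs_KInvStep_le (d := d) Lc j
  have h1 : ∀ l'' : Fin (d + 1), Summable fun w' : Fin (d + 1) → ℤ =>
      KInvStep (d := d) Lc j 0 w' (Sum.inr μ) (Sum.inl l'') * wH (N := Lc ^ j) (d := d) κ l'' (x - ((Lc ^ j : ℕ) : ℤ) • w') :=
    fun l'' => summable_mul_of_bdd (fun w' => hB 0 w' _ _) (summable_wH_sub_zsmul (Lc ^ j) κ l'' x)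
  have h2 : Summable fun w' : Fin (d + 1) → ℤ => ∑ l'' : Fin (d + 1),
      KInvStep (d := d) Lc j 0 w' (Sum.inr μ) (Sum.inl l'') * wH (N := Lc ^ j) (d := d) κ l'' (x - ((Lc ^ j : ℕ) : ℤ) • w') :=
    summable_sum fun l'' _ => h1 l''
  exact (h2.mul_left _).neg

/-- **`𝒬_{L^j}` OF THE COMPOSITE RETURNS THE COEFFICIENT** (each level-`L^j` minimiser column has unit contour sums,
`KernelSpecInstance.wH_Q`). [folklore] -/
theorem contourSum_compC (j : ℕ) (μ : Fin (d + 1)) (y'' : Fin (d + 1) → ℤ) :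
    contourSum (Lc ^ j)
        (fun l₂ y => comp (liftW (Lc ^ j) false true (KInvStep (d := d) Lc j)) (KInv (N := Lc ^ j) (d := d))
          0 y (Sum.inr μ) (Sum.inl l₂)) μ y''
      = -((((Lc ^ j : ℕ) : ℝ) ^ (d + 2)) * KInvStep (d := d) Lc j 0 y'' (Sum.inr μ) (Sum.inl μ)) := by
  simp only [compC_apply]
  rw [contourSum_tsum (L := Lc ^ j)
    (fun (w' : Fin (d + 1) → ℤ) (l₂ : Fin (d + 1)) (y : Fin (d + 1) → ℤ) => -((((Lc ^ j : ℕ) : ℝ) ^ (d + 2)) *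
      ∑ l'' : Fin (d + 1), KInvStep (d := d) Lc j 0 w' (Sum.inr μ) (Sum.inl l'') *
        wH (N := Lc ^ j) (d := d) l₂ l'' (y - ((Lc ^ j : ℕ) : ℤ) • w')))
    (fun κ x => summable_compC_term Lc j μ κ x)]
  have e : ∀ w' : Fin (d + 1) → ℤ,
      contourSum (Lc ^ j) (fun (l₂ : Fin (d + 1)) (y : Fin (d + 1) → ℤ) => -((((Lc ^ j : ℕ) : ℝ) ^ (d + 2)) *
        ∑ l'' : Fin (d + 1), KInvStep (d := d) Lc j 0 w' (Sum.inr μ) (Sum.inl l'') *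
          wH (N := Lc ^ j) (d := d) l₂ l'' (y - ((Lc ^ j : ℕ) : ℤ) • w'))) μ y''
        = if w' = y'' then -((((Lc ^ j : ℕ) : ℝ) ^ (d + 2)) * KInvStep (d := d) Lc j 0 y'' (Sum.inr μ) (Sum.inl μ))
          else 0 := by
    intro w'
    rw [contourSum_neg', contourSum_const_mul, contourSum_finset_sum]
    have e2 : ∀ l'' : Fin (d + 1),
        contourSum (Lc ^ j) (fun (l₂ : Fin (d + 1)) (y : Fin (d + 1) → ℤ) =>
            KInvStep (d := d) Lc j 0 w' (Sum.inr μ) (Sum.inl l'') * wH (N := Lc ^ j) (d := d) l₂ l'' (y - ((Lc ^ j : ℕ) : ℤ) • w'))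
            μ y''
          = KInvStep (d := d) Lc j 0 w' (Sum.inr μ) (Sum.inl l'') * (if y'' - w' = 0 ∧ μ = l'' then 1 else 0) := by
      intro l''
      rw [contourSum_const_mul, contourSum_shift (N := Lc ^ j) (fun κ z => wH (N := Lc ^ j) (d := d) κ l'' z) w' μ y'',
        wH_Q]
    simp only [e2, sub_eq_zero]
    by_cases hw : w' = y''
    · subst hw
      simp [mul_ite]
    · simp [Ne.symm hw, hw]
  rw [tsum_congr e, tsum_eq_single y'' (fun w' hw' => if_neg hw'), if_pos rfl]

/-- **(K1c′) IS FALSE AT EVERY STEP `j`** (every blocking factor `L ≥ 1`, every dimension).  Apply the finite contour sum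
`𝒬_{L^(j+1)}` in the fine variable to both sides at the coarse origin: the left side `ℋ♭_{L^(j+1)}(0, ·) = −ℋ_{L^(j+1)}(·, 0)ᵀ`
sums to `−1` (`wH_Q`), the right side — a superposition of level-`L^j` minimiser columns with the `ℋ♭`-entries of the
decimated resolvent as coefficients — sums to `(−(L^j)^(d+2)) · (−(L^j)^(−(d+2))) = +1` (`contourSum_compC`,
`StepDriftWitness.contourSum_compose`, `sum_KInvStep_inr_inl`).  The SIGN of the composite is wrong as typed; the corrected
statement is `K1cNeg`. [folklore] -/
theorem not_k1c' (j : ℕ) : ¬ K1c' (d := d) Lc j := by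
  intro h
  have hM : 0 < Lc ^ j := pow_pos (Nat.pos_of_ne_zero (NeZero.ne Lc)) j
  have hfun : (fun (l₂ : Fin (d + 1)) (y : Fin (d + 1) → ℤ) => -wH (N := Lc ^ (j + 1)) (d := d) l₂ (0 : Fin (d + 1)) y)
      = fun l₂ y => comp (liftW (Lc ^ j) false true (KInvStep (d := d) Lc j)) (KInv (N := Lc ^ j) (d := d))
          0 y (Sum.inr (0 : Fin (d + 1))) (Sum.inl l₂) := by
    funext l₂ y
    have h1 := h 0 y 0 l₂
    rw [KInv_inr_inl_coarse, GamΦ_eq_neg_wH, smul_zero, sub_zero] at h1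
    exact h1
  have hL : contourSum (Lc ^ (j + 1))
      (fun (l₂ : Fin (d + 1)) (y : Fin (d + 1) → ℤ) => -wH (N := Lc ^ (j + 1)) (d := d) l₂ (0 : Fin (d + 1)) y) 0 0 = -1 := by
    rw [contourSum_neg', wH_Q]
    simp
  have hR : contourSum (Lc ^ (j + 1))
      (fun l₂ y => comp (liftW (Lc ^ j) false true (KInvStep (d := d) Lc j)) (KInv (N := Lc ^ j) (d := d))
          0 y (Sum.inr (0 : Fin (d + 1))) (Sum.inl l₂)) 0 0 = 1 := by
    have hc := contourSum_compose (Lc ^ j) Lc hM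
      (fun l₂ y => comp (liftW (Lc ^ j) false true (KInvStep (d := d) Lc j)) (KInv (N := Lc ^ j) (d := d))
          0 y (Sum.inr (0 : Fin (d + 1))) (Sum.inl l₂)) 0
    rw [← pow_succ] at hc
    rw [← hc]
    simp only [contourSum_compC, Finset.sum_neg_distrib, ← Finset.mul_sum, sum_KInvStep_inr_inl]
    have hC : (((Lc ^ j : ℕ) : ℝ) ^ (d + 2)) ≠ 0 := pow_ne_zero _ (by exact_mod_cast hM.ne')
    rw [mul_neg, neg_neg, mul_inv_cancel₀ hC]
  rw [hfun] at hL
  rw [hL] at hR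
  norm_num at hR

/-- **THE INTERFACE BUNDLE IS FALSE AS TYPED**, for every blocking factor and every dimension: its `minOpL` field at `j = 1`
is `K1c' L 1`. [folklore] -/
theorem not_kktComposable : ¬ KKTComposable (d := d) Lc :=
  fun h => not_k1c' Lc 1 (h.minOpL 1 le_rfl)

end Refutation

/-! ## §6 Reproduction of the next level's minimiser columns by the level-`M` columns; (K1b′) and (K1c⁻) at EVERY step (v2) -/

section Reproduction

open ExpKernelCalculus (comp)
open OneStepKernelFamily (KInvStep colH dec legSet legW legPt LegIdx)
open InterLevelTransport (liftW slotW slotW_true slotW_false liftW_zsmul liftW_off liftW_inl_left liftW_inl_right)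
open StepDriftWitness (contourSum_compose sum_LegIdx_eq_contourSum dec_inl_inr)
open OneStepResolventKernel (KInv_inl_inr_coarse)
open KKTFluctuationUnique (repZ_mem_box)
open BlochFibreMatrix (eq_repZ_add_zsmul_quo)

variable {d : ℕ}

/-- **BLOCK-CONSTANCY DESCENDS TO A COMMENSURATE FINER BLOCKING**: an `ML`-block-constant function is `M`-block-constant
(every `M`-block lies inside one `ML`-block). [folklore] -/
theorem isBlockConst_of_mul {M L : ℕ} [NeZero L] {g : Form0 (d + 1) ℝ} (h : IsBlockConst (M * L) g) :
    IsBlockConst M g := by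
  intro y b hb
  have hr : (fun j => ((Torus.proj L y) j).val) ∈ box (d + 1) L := repZ_mem_box (N := L) (Torus.proj L y)
  have hy : y = (L : ℤ) • quo L y + toSite (fun j => ((Torus.proj L y) j).val) := by
    exact (eq_repZ_add_zsmul_quo (N := L) y).trans (add_comm _ _)
  simp only [AffineAveraging.box, Fintype.mem_piFinset, Finset.mem_range] at hb hr
  have hB₀ : (fun i => M * ((Torus.proj L y) i).val) ∈ box (d + 1) (M * L) := by
    simp only [AffineAveraging.box, Fintype.mem_piFinset, Finset.mem_range]
    intro i
    calc M * ((Torus.proj L y) i).val < M * ((Torus.proj L y) i).val + M := Nat.lt_add_of_pos_right ((Nat.zero_le _).trans_lt (hb i))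
      _ = M * (((Torus.proj L y) i).val + 1) := by ring
      _ ≤ M * L := Nat.mul_le_mul_left _ (hr i)
  have hB₁ : (fun i => M * ((Torus.proj L y) i).val + b i) ∈ box (d + 1) (M * L) := by
    simp only [AffineAveraging.box, Fintype.mem_piFinset, Finset.mem_range]
    intro i
    calc M * ((Torus.proj L y) i).val + b i < M * ((Torus.proj L y) i).val + M := Nat.add_lt_add_left (hb i) _
      _ = M * (((Torus.proj L y) i).val + 1) := by ring
      _ ≤ M * L := Nat.mul_le_mul_left _ (hr i)
  have e₀ : (M : ℤ) • y = ((M * L : ℕ) : ℤ) • quo L y + toSite (fun i => M * ((Torus.proj L y) i).val) := by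
    conv_lhs => rw [hy]
    funext i
    simp only [Pi.smul_apply, Pi.add_apply, toSite, smul_eq_mul]
    push_cast
    ring
  have e₁ : (M : ℤ) • y + toSite b = ((M * L : ℕ) : ℤ) • quo L y + toSite (fun i => M * ((Torus.proj L y) i).val + b i) := by
    conv_lhs => rw [hy]
    funext i
    simp only [Pi.smul_apply, Pi.add_apply, toSite, smul_eq_mul]
    push_cast
    ring
  rw [e₁, e₀, h _ _ hB₁, h _ _ hB₀]

/-- **THE SEMIGROUP LAW OF BLOCK-CONTOUR SUMS** at a general base point: `𝒬_{ML} = 𝒬_L ∘ 𝒬_M`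
(`StepDriftWitness.contourSum_compose` is the case of base point `0`). [folklore] -/
theorem contourSum_mul {D : ℕ} (M L : ℕ) (hM : 0 < M) (A : Form1 D ℝ) :
    contourSum (M * L) A = contourSum L (contourSum M A) := by
  funext κ Y
  have h1 : contourSum (M * L) A κ Y = contourSum (M * L) (fun l z => A l (z + ((M * L : ℕ) : ℤ) • Y)) κ 0 := by
    have h := contourSum_shift (N := M * L) A (-Y) κ 0
    simp only [smul_neg, sub_neg_eq_add, zero_add] at h
    exact h.symm
  rw [h1, ← contourSum_compose M L hM]
  change _ = ∑ b' ∈ box D L, ∑ s' ∈ Finset.range L, contourSum M A κ ((L : ℤ) • Y + toSite b' + (s' : ℤ) • unitVec κ)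
  refine Finset.sum_congr rfl fun b' _ => Finset.sum_congr rfl fun s' _ => ?_
  have h2 := contourSum_shift (N := M) A (-((L : ℤ) • Y)) κ (toSite b' + (s' : ℤ) • unitVec κ)
  simp only [smul_neg, sub_neg_eq_add, smul_smul] at h2
  have e : (fun l z => A l (z + ((M * L : ℕ) : ℤ) • Y)) = fun l z => A l (z + ((M : ℤ) * (L : ℤ)) • Y) := by
    funext l z
    push_cast
    rfl
  rw [e, h2]
  congr 1
  abel

/-- **REPRODUCTION OF THE LEVEL-`ML` MINIMISER COLUMNS BY THE LEVEL-`M` COLUMNS.**  For every coarse bond `(μ, z)` of the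
level-`N′ = ML` lattice, the translated minimiser column `T = ℋ_{N′}(·; μ, z)` is the superposition of the level-`M` minimiser
columns weighted by its own level-`M` block-contour sums: `T(κ₀, x₀) = Σ_{(l″,w′)} (𝒬_M T)(l″, w′) · ℋ_M(κ₀, x₀; l″, w′)`.
PROOF BY PAIRING (no uniqueness theorem is invoked): pair `T` with the Euler–Lagrange identity of the level-`M` covariance column
`Γ_M(·; κ₀, x₀)` (`KKTFluctuationEnergy.curvAdj_curv_Gcol`): the `𝒬_Mᵀ Φ^Γ` term gives minus the superposition
(`lip1_contourSumAdj`, `Φ^Γ = −ℋᵀ`, §2), the gauge term pairs to zero (`T`'s gauge quantity is `N′`-, hence `M`-block-constant,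
`isBlockConst_of_mul`, against the zero block means of the gauge multiplier), the unit force gives `T(κ₀, x₀)`; on the other
side, moving `d*d` across (`lip1_curvAdj` twice) and using `T`'s own Euler–Lagrange identity `d*dT = 𝒬_{N′}ᵀ Φ^T` (§2, no
gauge term by §1) the pairing is `Σ Φ^T · 𝒬_{N′} Γ_M = 0` because `𝒬_{N′} = 𝒬_L 𝒬_M` (`contourSum_mul`) and `𝒬_M Γ_M = 0`.
[folklore] -/
theorem wH_reproduction {N' M L : ℕ} [NeZero N'] [NeZero M] [NeZero L] (hN : N' = M * L) (μ : Fin (d + 1))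
    (z : Fin (d + 1) → ℤ) (κ₀ : Fin (d + 1)) (x₀ : Fin (d + 1) → ℤ) :
    wH (N := N') (d := d) κ₀ μ (x₀ - (N' : ℤ) • z)
      = ∑' w' : (Fin (d + 1) → ℤ), ∑ l'' : Fin (d + 1),
          contourSum M (Hcol (N := N') μ z) l'' w' * wH (N := M) (d := d) κ₀ l'' (x₀ - (M : ℤ) • w') := by
  subst hN
  obtain ⟨CT, _, hTb, hTs⟩ := Hcol_bdd_summable (N := M * L) (d := d)
  obtain ⟨CΦT, _, hΦT⟩ := HΦcol_bdd (N := M * L) (d := d)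
  obtain ⟨C, _, hbdd, hsum⟩ := Gcol_bdd_summable (N := M) (d := d)
  obtain ⟨CM, _, hMb, hMs⟩ := Mcol_bdd_summable (N := M) (d := d)
  obtain ⟨CΦ, _, hΦ⟩ := Φcol_bdd (N := M) (d := d)
  have hM : 0 < M := Nat.pos_of_ne_zero (NeZero.ne M)
  -- the pairing vanishes: `T`'s Euler–Lagrange identity and `𝒬_{ML} Γ_M = 𝒬_L 𝒬_M Γ_M = 0`
  have hP0 : lip1 (Hcol (N := M * L) μ z) (curvAdj (curv (Gcol (N := M) κ₀ x₀))) = 0 := by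
    rw [lip1_curvAdj (hTb μ z) (fun κ l => summable_curv (hsum κ₀ x₀) κ l), lip2_comm,
      ← lip1_curvAdj (hbdd κ₀ x₀) (fun κ l => summable_curv (hTs μ z) κ l), curvAdj_curv_Hcol,
      lip1_contourSumAdj (N := M * L) (hsum κ₀ x₀) (hΦT μ z)]
    refine (tsum_congr fun y => ?_).trans tsum_zero
    refine Finset.sum_eq_zero fun κ _ => ?_
    have h0 : contourSum M (Gcol (N := M) κ₀ x₀) = 0 := by
      funext κ' y'
      exact Gam_Q (N := M) κ₀ x₀ κ' y'
    have hQ : contourSum (M * L) (Gcol (N := M) κ₀ x₀) κ y = 0 := by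
      rw [contourSum_mul M L hM, h0]
      simp [contourSum]
    rw [hQ, mul_zero]
  -- the pairing computed from `Γ_M`'s Euler–Lagrange identity
  have h1 : lip1 (Hcol (N := M * L) μ z) (contourSumAdj M (Φcol (N := M) κ₀ x₀))
      = -∑' w' : (Fin (d + 1) → ℤ), ∑ l'' : Fin (d + 1),
          contourSum M (Hcol (N := M * L) μ z) l'' w' * wH (N := M) (d := d) κ₀ l'' (x₀ - (M : ℤ) • w') := by
    rw [lip1_contourSumAdj (N := M) (hTs μ z) (hΦ κ₀ x₀), ← tsum_neg]
    refine tsum_congr fun w' => ?_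
    rw [← Finset.sum_neg_distrib]
    refine Finset.sum_congr rfl fun l'' _ => ?_
    rw [show Φcol (N := M) κ₀ x₀ l'' w' = GamΦ (N := M) l'' w' κ₀ x₀ from rfl, GamΦ_eq_neg_wH]
    ring
  have h2 : lip1 (Hcol (N := M * L) μ z) (dz (codiff₁ (dz (Mcol (N := M) κ₀ x₀)))) = 0 := by
    have e1 : ∀ x, |codiff₁ (Hcol (N := M * L) μ z) x| ≤ (d + 1 : ℕ) * (2 * CT) := fun x => abs_codiff₁_le (hTb μ z) x
    have e2 : ∀ κ x, |dz (codiff₁ (Hcol (N := M * L) μ z)) κ x| ≤ 2 * ((d + 1 : ℕ) * (2 * CT)) := fun κ x =>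
      abs_dz_le e1 κ x
    have e3 : ∀ x, |codiff₁ (dz (codiff₁ (Hcol (N := M * L) μ z))) x| ≤ (d + 1 : ℕ) * (2 * (2 * ((d + 1 : ℕ) * (2 * CT)))) :=
      fun x => abs_codiff₁_le e2 x
    have hdzM : ∀ κ, Summable (dz (Mcol (N := M) κ₀ x₀) κ) := fun κ => summable_dz (hMs κ₀ x₀) κ
    rw [lip1_dz (hTb μ z) (summable_codiff₁ hdzM), lip0_codiff₁ e1 hdzM, lip1_dz e2 (hMs κ₀ x₀)]
    exact tsum_mul_eq_zero_of_blockConst (N := M) e3 (isBlockConst_of_mul (isBlockConst_Hcol (N := M * L) μ z))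
      (hMs κ₀ x₀) (GamM_M (N := M) κ₀ x₀)
  have h3 : lip1 (Hcol (N := M * L) μ z) (δcol κ₀ x₀) = Hcol (N := M * L) μ z κ₀ x₀ := by
    unfold lip1
    have e : ∀ x, ∑ μ' : Fin (d + 1), Hcol (N := M * L) μ z μ' x * δcol κ₀ x₀ μ' x
        = if x = x₀ then Hcol (N := M * L) μ z κ₀ x₀ else 0 := by
      intro x
      by_cases hx : x = x₀
      · subst hx
        simp [δcol]
      · simp [δcol, hx]
    rw [tsum_congr e, tsum_eq_single x₀ (fun x hx => if_neg hx), if_pos rfl]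
  have sT1 : ∀ μ', Summable (fun x => Hcol (N := M * L) μ z μ' x * contourSumAdj M (Φcol (N := M) κ₀ x₀) μ' x) :=
    fun μ' => summable_mul_of_bdd' (hTs μ z μ') (fun x => abs_contourSumAdj_le (hΦ κ₀ x₀) μ' x)
  have hT2b : ∀ μ' x, |dz (codiff₁ (dz (Mcol (N := M) κ₀ x₀))) μ' x| ≤ 2 * ((d + 1 : ℕ) * (2 * (2 * CM))) := fun μ' x =>
    abs_dz_le (fun z => abs_codiff₁_le (fun κ w => abs_dz_le (hMb κ₀ x₀) κ w) z) μ' x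
  have sT2 : ∀ μ', Summable (fun x => Hcol (N := M * L) μ z μ' x * dz (codiff₁ (dz (Mcol (N := M) κ₀ x₀))) μ' x) :=
    fun μ' => summable_mul_of_bdd' (hTs μ z μ') (hT2b μ')
  have sδ : ∀ μ', Summable (fun x => Hcol (N := M * L) μ z μ' x * δcol κ₀ x₀ μ' x) := fun μ' =>
    summable_mul_of_bdd' (M := 1) (hTs μ z μ') (fun x => by
      unfold δcol
      split_ifs <;> simp)
  have s12 : ∀ μ', Summable (fun x => Hcol (N := M * L) μ z μ' x
      * (contourSumAdj M (Φcol (N := M) κ₀ x₀) + dz (codiff₁ (dz (Mcol (N := M) κ₀ x₀)))) μ' x) := fun μ' => by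
    have h := (sT1 μ').add (sT2 μ')
    simpa only [Pi.add_apply, mul_add] using h
  have hP : lip1 (Hcol (N := M * L) μ z) (curvAdj (curv (Gcol (N := M) κ₀ x₀)))
      = -(∑' w' : (Fin (d + 1) → ℤ), ∑ l'' : Fin (d + 1),
          contourSum M (Hcol (N := M * L) μ z) l'' w' * wH (N := M) (d := d) κ₀ l'' (x₀ - (M : ℤ) • w')) + 0
        + Hcol (N := M * L) μ z κ₀ x₀ := by
    rw [curvAdj_curv_Gcol, lip1_add s12 sδ, lip1_add sT1 sT2, h1, h2, h3]
  rw [hP0, Hcol_apply] at hP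
  linarith

variable (Lc : ℕ) [NeZero Lc]

omit [NeZero Lc] in
/-- Cast bookkeeping: `L^j • (L • z) = L^(j+1) • z`. [folklore] -/
theorem zsmul_pow_succ (j : ℕ) (z : Fin (d + 1) → ℤ) :
    ((Lc ^ j : ℕ) : ℤ) • (((Lc : ℕ) : ℤ) • z) = ((Lc ^ (j + 1) : ℕ) : ℤ) • z := by
  rw [smul_smul, ← Nat.cast_mul, ← pow_succ]

/-- THE `(inl, inr)` ENTRIES OF THE DECIMATED COMPOSITE RESOLVENT at a coarse second argument: `(L^j)^{−(d+2)}` times the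
`L^j`-block-contour sum of the level-`L^(j+1)` minimiser column. [folklore] -/
theorem KInvStep_inl_inr (j : ℕ) (κ μ : Fin (d + 1)) (w' z : Fin (d + 1) → ℤ) :
    KInvStep (d := d) Lc j w' (((Lc : ℕ) : ℤ) • z) (Sum.inl κ) (Sum.inr μ)
      = (((Lc ^ j : ℕ) : ℝ) ^ (d + 2))⁻¹ * contourSum (Lc ^ j) (Hcol (N := Lc ^ (j + 1)) μ z) κ w' := by
  unfold KInvStep
  rw [dec_inl_inr, ← sum_LegIdx_eq_contourSum]
  congr 1
  refine Finset.sum_congr rfl fun i _ => ?_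
  rw [zsmul_pow_succ, KInv_inl_inr_coarse, Hcol_apply]

/-- THE `(inr, inl)` ENTRIES at a coarse first argument: MINUS the same (`ℋ♭ = −ℋᵀ`, §2). [folklore] -/
theorem KInvStep_inr_inl (j : ℕ) (μ l : Fin (d + 1)) (z w' : Fin (d + 1) → ℤ) :
    KInvStep (d := d) Lc j (((Lc : ℕ) : ℤ) • z) w' (Sum.inr μ) (Sum.inl l)
      = -((((Lc ^ j : ℕ) : ℝ) ^ (d + 2))⁻¹ * contourSum (Lc ^ j) (Hcol (N := Lc ^ (j + 1)) μ z) l w') := by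
  unfold KInvStep
  rw [dec_inr_inl, zsmul_pow_succ, ← sum_LegIdx_eq_contourSum, ← mul_neg, ← Finset.sum_neg_distrib]
  congr 1
  refine Finset.sum_congr rfl fun i _ => ?_
  rw [KInv_inr_inl_coarse, GamΦ_eq_neg_wH, Hcol_apply]

/-- THE COMPOSITE OF (K1b′) IS THE SUPERPOSITION OF LEVEL-`L^j` MINIMISER COLUMNS weighted by the `L^j`-block-contour sums of the
level-`L^(j+1)` column (sublattice re-indexing, `liftW` pins, `KInvStep_inl_inr`). [folklore] -/
theorem compB_apply (j : ℕ) (x z : Fin (d + 1) → ℤ) (κ μ : Fin (d + 1)) :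
    comp (KInv (N := Lc ^ j) (d := d)) (liftW (Lc ^ j) true false (KInvStep (d := d) Lc j))
        x (((Lc ^ (j + 1) : ℕ) : ℤ) • z) (Sum.inl κ) (Sum.inr μ)
      = ∑' w' : (Fin (d + 1) → ℤ), ∑ l'' : Fin (d + 1),
          contourSum (Lc ^ j) (Hcol (N := Lc ^ (j + 1)) μ z) l'' w' * wH (N := Lc ^ j) (d := d) κ l'' (x - ((Lc ^ j : ℕ) : ℤ) • w') := by
  have hC : (((Lc ^ j : ℕ) : ℝ) ^ (d + 2)) ≠ 0 :=
    pow_ne_zero _ (by exact_mod_cast (pow_pos (Nat.pos_of_ne_zero (NeZero.ne Lc)) j).ne')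
  unfold ExpKernelCalculus.comp
  rw [← zsmul_pow_succ Lc j z]
  refine tsum_sublattice₀ (Lc ^ j) _ _ (fun w hw => ?_) (fun w' => ?_)
  · simp only [liftW_off (Lc ^ j) true false _ (Or.inl hw), mul_zero, Finset.sum_const_zero]
  · rw [Fintype.sum_sum_type]
    simp only [liftW_inl_left, mul_zero, Finset.sum_const_zero, zero_add, liftW_zsmul, KInv_inl_inr_coarse,
      slotW_true, slotW_false, mul_one, slot_true, slot_false, KInvStep_inl_inr]
    refine Finset.sum_congr rfl fun l'' _ => ?_
    field_simp

/-- THE COMPOSITE OF (K1c⁻) IS THE SAME SUPERPOSITION read on the other leg (`ℋ♭ = −ℋᵀ` twice). [folklore] -/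
theorem compC_apply' (j : ℕ) (z y : Fin (d + 1) → ℤ) (μ l : Fin (d + 1)) :
    comp (liftW (Lc ^ j) false true (KInvStep (d := d) Lc j)) (KInv (N := Lc ^ j) (d := d))
        (((Lc ^ (j + 1) : ℕ) : ℤ) • z) y (Sum.inr μ) (Sum.inl l)
      = ∑' w' : (Fin (d + 1) → ℤ), ∑ l'' : Fin (d + 1),
          contourSum (Lc ^ j) (Hcol (N := Lc ^ (j + 1)) μ z) l'' w' * wH (N := Lc ^ j) (d := d) l l'' (y - ((Lc ^ j : ℕ) : ℤ) • w') := by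
  have hC : (((Lc ^ j : ℕ) : ℝ) ^ (d + 2)) ≠ 0 :=
    pow_ne_zero _ (by exact_mod_cast (pow_pos (Nat.pos_of_ne_zero (NeZero.ne Lc)) j).ne')
  unfold ExpKernelCalculus.comp
  rw [← zsmul_pow_succ Lc j z]
  refine tsum_sublattice₀ (Lc ^ j) _ _ (fun w hw => ?_) (fun w' => ?_)
  · simp only [liftW_off (Lc ^ j) false true _ (Or.inr hw), zero_mul, Finset.sum_const_zero]
  · rw [Fintype.sum_sum_type]
    simp only [liftW_inl_right, zero_mul, Finset.sum_const_zero, zero_add, liftW_zsmul, KInv_inr_inl_coarse,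
      GamΦ_eq_neg_wH, slotW_true, slotW_false, one_mul, slot_true, slot_false, KInvStep_inr_inl]
    refine Finset.sum_congr rfl fun l'' _ => ?_
    field_simp

/-- **(K1b′) HOLDS AT EVERY STEP `j`** (every blocking factor, every dimension): the minimiser column of level `L^(j+1)` is the
level-`L^j` resolvent applied to the lifted `ℋ`-column of the decimated resolvent (`wH_reproduction` + `compB_apply`).
[folklore] -/
theorem k1b' (j : ℕ) : K1b' (d := d) Lc j := by
  intro x z κ μ
  rw [compB_apply]
  show KInv (N := Lc ^ (j + 1)) (d := d) x (((Lc ^ (j + 1) : ℕ) : ℤ) • z) (Sum.inl κ) (Sum.inr μ) = _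
  rw [KInv_inl_inr_coarse]
  exact wH_reproduction (pow_succ Lc j) μ z κ x

/-- **(K1c⁻) HOLDS AT EVERY STEP `j`**: the sign-corrected left-companion identity (`wH_reproduction` + `compC_apply'`).
[folklore] -/
theorem k1cNeg (j : ℕ) : K1cNeg (d := d) Lc j := by
  intro z y μ l
  rw [compC_apply', KInv_inr_inl_coarse, GamΦ_eq_neg_wH, wH_reproduction (pow_succ Lc j) μ z l y]

/-- The `minOp` field of the bundle holds at every `j` (so the bundle is false ONLY through its other two fields). [folklore] -/
theorem kktComposable_minOp (j : ℕ) (_hj : 1 ≤ j) : K1b' (d := d) Lc j := k1b' Lc j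

end Reproduction

/-! ## §7 Transverse decomposition (v3): covariance fields with CO-CLOSED forces

For a finite combination `U = Σ_{b ∈ S} a_b Γ_b` of covariance columns (`KKTFluctuationEnergy.GcolSum`) whose force
`Σ_{b ∈ S} a_b δ_b` is CO-CLOSED (`codiff₁ (δSum S a) = 0`; e.g. `a` = a finitely supported co-closed test form):
* `McolSum_eq_zero` — **ITS GAUGE MULTIPLIER VANISHES** at every level `N` (the mechanism of §1 `wM_eq_zero`: `codiff₁` of the
  Euler–Lagrange identity `curvAdj_curv_GcolSum` makes `Δ₀² m` block-constant because `codiff₁ ∘ curvAdj = 0`,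
  `codiff₁ ∘ 𝒬ᵀ_N` is block-constant (§1) and the force is co-closed; then (M) and two adjunctions).  For a force that is NOT
  co-closed the multiplier does not vanish (numerically `O(1)`): this is the gauge-slice defect that kills (K1a′)/(K1a⁻)
  entrywise for `j ≥ 1`.
* `GcolSum_decomposition` — **THE TWO-LEVEL DECOMPOSITION**: for `N′ = ML`,
  `U_{N′}(κ₀, x₀) = U_M(κ₀, x₀) + Σ_{(l″, w′)} (𝒬_M U_{N′})(l″, w′) · ℋ_M(κ₀, x₀; l″, w′)` — Green pairing of `U_{N′}` against
  the Euler–Lagrange identity of `Γ_M(·; κ₀, x₀)` exactly as in `wH_reproduction` (§6): the cross gauge term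
  `⟨Γ_M-column, dδd m_U⟩` is where `McolSum_eq_zero` (level `N′`) enters, `contourSum_mul` + `Gam_Q` kill the `𝒬_{N′}ᵀ Φ^U`
  term, and `Gam_symm` recognises `U_M(κ₀, x₀)` in `⟨Γ_M(·; κ₀, x₀), Σ a_b δ_b⟩`.
These are steps (S3) and (A) of the all-`j` proof of (K1aᵀ) recorded (with torus numerics) in the node's `NUMERICS.md` v2;
the remaining step (B) — r₀ = `𝒬_M U_{N′}` and `𝒬_M Γ_{N′} 𝒬_Mᵀ ℋ_Mᵀ a` are both stationary, over `ker 𝒬_L`, for the level-`M`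
effective action with source `ℋ_Mᵀ a`, so `ℋ_M` of their difference is closed and pairs to zero with co-closed test forms —
is the successor's. -/

section Transverse

open KKTFluctuationEnergy (GcolSum curv_GcolSum Gam_symm)
open KernelSpecInstance (curv_add curv_smul curvAdj_add curvAdj_smul codiff₁_smul dz_smul contourSumAdj_add
  contourSumAdj_smul)
open AffineReproduction (dz_add)

variable {d : ℕ}

/-- `|Σ_{i ∈ S} a_i f_i| ≤ (Σ |a_i|) · C` when `|f_i| ≤ C` on `S`. [folklore] -/
theorem abs_sum_mul_le {ι : Type*} (S : Finset ι) (a f : ι → ℝ) {C : ℝ} (h : ∀ i ∈ S, |f i| ≤ C) :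
    |∑ i ∈ S, a i * f i| ≤ (∑ i ∈ S, |a i|) * C := by
  calc |∑ i ∈ S, a i * f i| ≤ ∑ i ∈ S, |a i * f i| := Finset.abs_sum_le_sum_abs _ _
    _ ≤ ∑ i ∈ S, |a i| * C := Finset.sum_le_sum fun i hi => by
        rw [abs_mul]
        exact mul_le_mul_of_nonneg_left (h i hi) (abs_nonneg _)
    _ = (∑ i ∈ S, |a i|) * C := by rw [Finset.sum_mul]

/-- `lip1` of a finite linear combination in the second slot (as `ScalarBlockGreen.lip1_sum_right`, which this leaf does
not import). [folklore] -/
theorem lip1_sum_right' {D : ℕ} {ι : Type*} (S : Finset ι) (c : ι → ℝ) (A : ι → Form1 D ℝ) (B : Form1 D ℝ)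
    (h : ∀ i ∈ S, ∀ μ, Summable (fun x => B μ x * A i μ x)) :
    lip1 B (fun μ x => ∑ i ∈ S, c i * A i μ x) = ∑ i ∈ S, c i * lip1 B (A i) := by
  unfold lip1
  have e : ∀ x : AffineAveraging.Site D, ∑ μ, B μ x * (∑ i ∈ S, c i * A i μ x)
      = ∑ i ∈ S, c i * ∑ μ, B μ x * A i μ x := by
    intro x
    simp only [Finset.mul_sum, mul_left_comm (B _ x)]
    exact Finset.sum_comm
  refine (tsum_congr e).trans ?_
  rw [Summable.tsum_finsetSum (fun i hi => (summable_sum fun μ _ => h i hi μ).mul_left (c i))]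
  exact Finset.sum_congr rfl fun i _ => tsum_mul_left

/-- The force `Σ_{b ∈ S} a_b δ_b` of a finite combination of covariance columns. [folklore] -/
def δSum (S : Finset (Fin (d + 1) × AffineAveraging.Site (d + 1)))
    (a : Fin (d + 1) × AffineAveraging.Site (d + 1) → ℝ) : Form1 (d + 1) ℝ :=
  fun μ x => ∑ b ∈ S, a b * δcol b.1 b.2 μ x

/-- `Σ_{insert b S} = a_b δ_b + Σ_S`. [folklore] -/
theorem δSum_insert {b : Fin (d + 1) × AffineAveraging.Site (d + 1)}
    {S : Finset (Fin (d + 1) × AffineAveraging.Site (d + 1))} (hb : b ∉ S)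
    (a : Fin (d + 1) × AffineAveraging.Site (d + 1) → ℝ) : δSum (insert b S) a = a b • δcol b.1 b.2 + δSum S a := by
  funext μ x
  simp [δSum, Finset.sum_insert hb]

variable [NeZero N]

/-- The gauge multiplier `Σ a_b M_b` of the combination. [folklore] -/
def McolSum (S : Finset (Fin (d + 1) × AffineAveraging.Site (d + 1)))
    (a : Fin (d + 1) × AffineAveraging.Site (d + 1) → ℝ) : Form0 (d + 1) ℝ :=
  fun z => ∑ b ∈ S, a b * Mcol (N := N) b.1 b.2 z

/-- The constraint multiplier `Σ a_b Φ_b` of the combination. [folklore] -/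
def ΦcolSum (S : Finset (Fin (d + 1) × AffineAveraging.Site (d + 1)))
    (a : Fin (d + 1) × AffineAveraging.Site (d + 1) → ℝ) : Form1 (d + 1) ℝ :=
  fun κ q => ∑ b ∈ S, a b * Φcol (N := N) b.1 b.2 κ q

/-- `Σ_{insert b S} = a_b Γ_b + Σ_S`. [folklore] -/
theorem GcolSum_insert {b : Fin (d + 1) × AffineAveraging.Site (d + 1)}
    {S : Finset (Fin (d + 1) × AffineAveraging.Site (d + 1))} (hb : b ∉ S)
    (a : Fin (d + 1) × AffineAveraging.Site (d + 1) → ℝ) :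
    GcolSum (N := N) (insert b S) a = a b • Gcol (N := N) b.1 b.2 + GcolSum (N := N) S a := by
  funext κ x
  simp [GcolSum, Finset.sum_insert hb]

/-- `Σ_{insert b S} = a_b M_b + Σ_S`. [folklore] -/
theorem McolSum_insert {b : Fin (d + 1) × AffineAveraging.Site (d + 1)}
    {S : Finset (Fin (d + 1) × AffineAveraging.Site (d + 1))} (hb : b ∉ S)
    (a : Fin (d + 1) × AffineAveraging.Site (d + 1) → ℝ) :
    McolSum (N := N) (insert b S) a = a b • Mcol (N := N) b.1 b.2 + McolSum (N := N) S a := by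
  funext z
  simp [McolSum, Finset.sum_insert hb]

/-- `Σ_{insert b S} = a_b Φ_b + Σ_S`. [folklore] -/
theorem ΦcolSum_insert {b : Fin (d + 1) × AffineAveraging.Site (d + 1)}
    {S : Finset (Fin (d + 1) × AffineAveraging.Site (d + 1))} (hb : b ∉ S)
    (a : Fin (d + 1) × AffineAveraging.Site (d + 1) → ℝ) :
    ΦcolSum (N := N) (insert b S) a = a b • Φcol (N := N) b.1 b.2 + ΦcolSum (N := N) S a := by
  funext κ q
  simp [ΦcolSum, Finset.sum_insert hb]

/-- (EL) FOR A FINITE COMBINATION OF COVARIANCE COLUMNS, as an identity of 1-forms (linearity over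
`KKTFluctuationEnergy.curvAdj_curv_Gcol`). [folklore] -/
theorem curvAdj_curv_GcolSum (S : Finset (Fin (d + 1) × AffineAveraging.Site (d + 1)))
    (a : Fin (d + 1) × AffineAveraging.Site (d + 1) → ℝ) :
    curvAdj (curv (GcolSum (N := N) S a))
      = contourSumAdj N (ΦcolSum (N := N) S a) + dz (codiff₁ (dz (McolSum (N := N) S a))) + δSum S a := by
  classical
  induction S using Finset.induction_on with
  | empty =>
    funext μ x
    simp [GcolSum, ΦcolSum, McolSum, δSum, curvAdj, curv, contourSumAdj_eq, dz, codiff₁]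
  | @insert b S hb ih =>
    rw [GcolSum_insert hb, ΦcolSum_insert hb, McolSum_insert hb, δSum_insert hb, curv_add, curv_smul, curvAdj_add,
      curvAdj_smul, ih, curvAdj_curv_Gcol, contourSumAdj_add, contourSumAdj_smul, dz_add, dz_smul, codiff₁_add,
      codiff₁_smul, dz_add, dz_smul, smul_add, smul_add]
    abel

/-- (M) for the combination: zero block sums of its gauge multiplier. [folklore] -/
theorem blockSum_McolSum (S : Finset (Fin (d + 1) × AffineAveraging.Site (d + 1)))
    (a : Fin (d + 1) × AffineAveraging.Site (d + 1) → ℝ) (y : AffineAveraging.Site (d + 1)) :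
    blockSum N (McolSum (N := N) S a) y = 0 := by
  simp only [McolSum, blockSum]
  rw [Finset.sum_comm]
  refine Finset.sum_eq_zero fun b _ => ?_
  rw [← Finset.mul_sum]
  have h0 : ∑ x ∈ box (d + 1) N, Mcol (N := N) b.1 b.2 ((N : ℤ) • y + toSite x) = 0 := GamM_M (N := N) b.1 b.2 y
  rw [h0, mul_zero]

/-- (G) for the combination: its gauge quantity is block-constant. [folklore] -/
theorem isBlockConst_GcolSum (S : Finset (Fin (d + 1) × AffineAveraging.Site (d + 1)))
    (a : Fin (d + 1) × AffineAveraging.Site (d + 1) → ℝ) :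
    IsBlockConst N (codiff₁ (dz (codiff₁ (GcolSum (N := N) S a)))) := by
  classical
  induction S using Finset.induction_on with
  | empty =>
    intro y c hc
    simp [GcolSum, codiff₁, dz]
  | @insert b S hb ih =>
    rw [GcolSum_insert hb, codiff₁_add, codiff₁_smul, dz_add, dz_smul, codiff₁_add, codiff₁_smul]
    intro y c hc
    simp only [Pi.add_apply, Pi.smul_apply, smul_eq_mul]
    have hG := Gam_G (N := N) b.1 b.2 y c hc
    rw [show (fun κ z => Gam (N := N) κ z b.1 b.2) = Gcol (N := N) b.1 b.2 from rfl] at hG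
    rw [ih y c hc, hG]

/-- Uniform bounds and summability of the combination and of its multipliers. [folklore] -/
theorem GcolSum_bdd_summable (S : Finset (Fin (d + 1) × AffineAveraging.Site (d + 1)))
    (a : Fin (d + 1) × AffineAveraging.Site (d + 1) → ℝ) :
    ∃ C : ℝ, (∀ κ x, |GcolSum (N := N) S a κ x| ≤ C) ∧ (∀ κ, Summable (GcolSum (N := N) S a κ))
      ∧ (∀ κ q, |ΦcolSum (N := N) S a κ q| ≤ C) ∧ (∀ z, |McolSum (N := N) S a z| ≤ C)
      ∧ Summable (McolSum (N := N) S a) := by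
  obtain ⟨C, _, hbdd, hsum⟩ := Gcol_bdd_summable (N := N) (d := d)
  obtain ⟨CM, _, hMb, hMs⟩ := Mcol_bdd_summable (N := N) (d := d)
  obtain ⟨CΦ, _, hΦ⟩ := Φcol_bdd (N := N) (d := d)
  refine ⟨(∑ b ∈ S, |a b|) * (C + CM + CΦ), fun κ x => ?_, fun κ => ?_, fun κ q => ?_, fun z => ?_, ?_⟩
  · refine (abs_sum_mul_le S a _ fun b _ => hbdd b.1 b.2 κ x).trans ?_
    exact mul_le_mul_of_nonneg_left (by linarith) (Finset.sum_nonneg fun b _ => abs_nonneg _)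
  · exact summable_sum fun b _ => (hsum b.1 b.2 κ).mul_left (a b)
  · refine (abs_sum_mul_le S a _ fun b _ => hΦ b.1 b.2 κ q).trans ?_
    exact mul_le_mul_of_nonneg_left (by linarith) (Finset.sum_nonneg fun b _ => abs_nonneg _)
  · refine (abs_sum_mul_le S a _ fun b _ => hMb b.1 b.2 z).trans ?_
    exact mul_le_mul_of_nonneg_left (by linarith) (Finset.sum_nonneg fun b _ => abs_nonneg _)
  · exact summable_sum fun b _ => (hMs b.1 b.2).mul_left (a b)

/-- **THE GAUGE MULTIPLIER OF A COVARIANCE FIELD WITH CO-CLOSED FORCE VANISHES.** [folklore] -/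
theorem McolSum_eq_zero (S : Finset (Fin (d + 1) × AffineAveraging.Site (d + 1)))
    (a : Fin (d + 1) × AffineAveraging.Site (d + 1) → ℝ) (hco : codiff₁ (δSum S a) = 0) :
    McolSum (N := N) S a = 0 := by
  obtain ⟨K, _, _, hΦb, hμb, hμs⟩ := GcolSum_bdd_summable (N := N) S a
  have hM : ∀ y, blockSum N (McolSum (N := N) S a) y = 0 := blockSum_McolSum (N := N) S a
  have hEL := curvAdj_curv_GcolSum (N := N) S a
  set μ : Form0 (d + 1) ℝ := McolSum (N := N) S a with hμdef
  have hg : codiff₁ (dz (codiff₁ (dz μ))) = -codiff₁ (contourSumAdj N (ΦcolSum (N := N) S a)) := by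
    have h := congrArg codiff₁ hEL
    rw [codiff₁_curvAdj, codiff₁_add, codiff₁_add, hco, add_zero] at h
    exact eq_neg_of_add_eq_zero_right h.symm
  have hgc : IsBlockConst N (codiff₁ (dz (codiff₁ (dz μ)))) := by
    intro y b hb
    rw [hg, Pi.neg_apply, Pi.neg_apply, isBlockConst_codiff₁_contourSumAdj _ y b hb]
  have hgb : ∀ x, |codiff₁ (dz (codiff₁ (dz μ))) x| ≤ (d + 1 : ℕ) * (2 * K) := by
    intro x
    rw [hg, Pi.neg_apply, abs_neg, codiff₁_contourSumAdj]
    exact abs_codiff₁_le hΦb _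
  -- step 1: `∑' g·μ = 0`
  have hsum0 : ∑' x, codiff₁ (dz (codiff₁ (dz μ))) x * μ x = 0 :=
    tsum_mul_eq_zero_of_blockConst (N := N) hgb hgc hμs hM
  -- step 2: two adjunctions
  have hdzμ : ∀ κ, Summable (dz μ κ) := fun κ => summable_dz hμs κ
  have hΔ : Summable (codiff₁ (dz μ)) := summable_codiff₁ hdzμ
  have hdzΔ : ∀ κ, Summable (dz (codiff₁ (dz μ)) κ) := fun κ => summable_dz hΔ κ
  have hdzμb : ∀ κ x, |dz μ κ x| ≤ 2 * K := fun κ x => abs_dz_le hμb κ x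
  have hΔb : ∀ x, |codiff₁ (dz μ) x| ≤ (d + 1 : ℕ) * (2 * (2 * K)) := fun x => abs_codiff₁_le hdzμb x
  have e1 : lip0 μ (codiff₁ (dz (codiff₁ (dz μ)))) = lip1 (dz μ) (dz (codiff₁ (dz μ))) := lip0_codiff₁ hμb hdzΔ
  have e2 : lip1 (dz μ) (dz (codiff₁ (dz μ))) = lip0 (codiff₁ (dz μ)) (codiff₁ (dz μ)) := lip1_dz hdzμb hΔ
  have e0 : lip0 μ (codiff₁ (dz (codiff₁ (dz μ)))) = 0 := by
    unfold lip0
    rw [← hsum0]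
    exact tsum_congr (fun x => mul_comm _ _)
  have hsq : ∑' x, codiff₁ (dz μ) x * codiff₁ (dz μ) x = 0 := by
    have h := e0
    rw [e1, e2] at h
    exact h
  -- step 3: `Δ₀ μ = 0`
  have hΔ0 : codiff₁ (dz μ) = 0 := by
    have hnn : ∀ x, 0 ≤ codiff₁ (dz μ) x * codiff₁ (dz μ) x := fun x => mul_self_nonneg _
    have hs2 : Summable (fun x => codiff₁ (dz μ) x * codiff₁ (dz μ) x) := summable_mul_of_bdd hΔb hΔ
    have hz := (hasSum_zero_iff_of_nonneg hnn).1 (by rw [← hsq]; exact hs2.hasSum)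
    funext x
    exact mul_self_eq_zero.mp (congr_fun hz x)
  -- step 4: `∑ |dμ|² = ⟨dμ, dμ⟩ = ⟨Δ₀ μ, μ⟩ = 0`
  have e3 : lip1 (dz μ) (dz μ) = lip0 (codiff₁ (dz μ)) μ := lip1_dz hdzμb hμs
  have hsq1 : ∑' x, ∑ κ, dz μ κ x * dz μ κ x = 0 := by
    have h := e3
    rw [hΔ0] at h
    unfold lip1 lip0 at h
    simpa using h
  have hdz0 : ∀ κ x, dz μ κ x = 0 := by
    have hnn : ∀ x, 0 ≤ ∑ κ, dz μ κ x * dz μ κ x := fun x => Finset.sum_nonneg fun κ _ => mul_self_nonneg _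
    have hs3 : Summable (fun x => ∑ κ, dz μ κ x * dz μ κ x) :=
      summable_sum fun κ _ => summable_mul_of_bdd (hdzμb κ) (hdzμ κ)
    have hz := (hasSum_zero_iff_of_nonneg hnn).1 (by rw [← hsq1]; exact hs3.hasSum)
    intro κ x
    have hx : ∑ κ, dz μ κ x * dz μ κ x = 0 := congr_fun hz x
    exact mul_self_eq_zero.mp
      ((Finset.sum_eq_zero_iff_of_nonneg (fun κ _ => mul_self_nonneg (dz μ κ x))).1 hx κ (Finset.mem_univ κ))
  -- step 5: translation invariance + summability
  have hinv : ∀ x, μ (x + unitVec 0) = μ x := fun x => by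
    have h := hdz0 0 x
    simp only [dz] at h
    linarith
  have hv : (unitVec 0 : AffineAveraging.Site (d + 1)) ≠ 0 := by
    intro h
    have := congr_fun h 0
    simp [unitVec_apply] at this
  exact eq_zero_of_summable_of_shift_invariant hμs hv hinv


/-- (EL) of the combination WITHOUT gauge term when its force is co-closed. [folklore] -/
theorem curvAdj_curv_GcolSum_of_coclosed (S : Finset (Fin (d + 1) × AffineAveraging.Site (d + 1)))
    (a : Fin (d + 1) × AffineAveraging.Site (d + 1) → ℝ) (hco : codiff₁ (δSum S a) = 0) :
    curvAdj (curv (GcolSum (N := N) S a)) = contourSumAdj N (ΦcolSum (N := N) S a) + δSum S a := by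
  rw [curvAdj_curv_GcolSum, McolSum_eq_zero (N := N) S a hco]
  have h0 : dz (codiff₁ (dz (0 : Form0 (d + 1) ℝ))) = 0 := by
    funext κ x
    simp [dz, codiff₁]
  rw [h0, add_zero]

omit [NeZero N] in
/-- `|Σ a_b δ_b| ≤ Σ |a_b|`. [folklore] -/
theorem abs_δSum_le (S : Finset (Fin (d + 1) × AffineAveraging.Site (d + 1)))
    (a : Fin (d + 1) × AffineAveraging.Site (d + 1) → ℝ) (μ : Fin (d + 1)) (x : AffineAveraging.Site (d + 1)) :
    |δSum S a μ x| ≤ (∑ b ∈ S, |a b|) * 1 :=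
  abs_sum_mul_le S a _ fun b _ => by
    unfold δcol
    split_ifs <;> simp

/-- `⟨Γ_M(·; κ₀, x₀), Σ a_b δ_b⟩ = U_M(κ₀, x₀)` (`lip1_Gcol_δcol` + `Gam_symm`). [folklore] -/
theorem lip1_Gcol_δSum (S : Finset (Fin (d + 1) × AffineAveraging.Site (d + 1)))
    (a : Fin (d + 1) × AffineAveraging.Site (d + 1) → ℝ) (κ₀ : Fin (d + 1)) (x₀ : AffineAveraging.Site (d + 1)) :
    lip1 (Gcol (N := N) κ₀ x₀) (δSum S a) = GcolSum (N := N) S a κ₀ x₀ := by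
  obtain ⟨C, _, hbdd, hsum⟩ := Gcol_bdd_summable (N := N) (d := d)
  have h := lip1_sum_right' S a (fun b => δcol b.1 b.2) (Gcol (N := N) κ₀ x₀) (fun b _ μ =>
    summable_mul_of_bdd' (M := 1) (hsum κ₀ x₀ μ) (fun x => by
      unfold δcol
      split_ifs <;> simp))
  rw [show δSum S a = fun μ x => ∑ b ∈ S, a b * δcol b.1 b.2 μ x from rfl, h]
  refine Finset.sum_congr rfl fun b _ => ?_
  rw [lip1_Gcol_δcol, Gam_symm]
  rfl

/-- **THE TWO-LEVEL DECOMPOSITION OF A COVARIANCE FIELD WITH CO-CLOSED FORCE.**  For `N′ = ML` and a finite combination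
`U_{N′} = Σ a_b Γ_{N′, b}` with co-closed force, `U_{N′} = U_M + Σ_{(l″, w′)} (𝒬_M U_{N′})(l″, w′) · ℋ_M(·; l″, w′)`:
the level-`N′` covariance field is the level-`M` covariance field of the same force plus the level-`M` minimiser of its
own level-`M` block averages.  PROOF BY PAIRING against the Euler–Lagrange identity of `Γ_M(·; κ₀, x₀)`, as
`wH_reproduction`; the gauge cross term needs `McolSum_eq_zero` at level `N′` (this is where co-closedness enters), the
`𝒬_{N′}ᵀ Φ^U` term dies by `contourSum_mul` + `Gam_Q`, and `lip1_Gcol_δSum` recognises `U_M(κ₀, x₀)`. [folklore] -/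
theorem GcolSum_decomposition {N' M L : ℕ} [NeZero N'] [NeZero M] [NeZero L] (hN : N' = M * L)
    (S : Finset (Fin (d + 1) × AffineAveraging.Site (d + 1))) (a : Fin (d + 1) × AffineAveraging.Site (d + 1) → ℝ)
    (hco : codiff₁ (δSum S a) = 0) (κ₀ : Fin (d + 1)) (x₀ : AffineAveraging.Site (d + 1)) :
    GcolSum (N := N') S a κ₀ x₀
      = GcolSum (N := M) S a κ₀ x₀ + ∑' w' : (Fin (d + 1) → ℤ), ∑ l'' : Fin (d + 1),
          contourSum M (GcolSum (N := N') S a) l'' w' * wH (N := M) (d := d) κ₀ l'' (x₀ - (M : ℤ) • w') := by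
  subst hN
  obtain ⟨K, hUb, hUs, hΦUb, _, _⟩ := GcolSum_bdd_summable (N := M * L) S a
  have hELU := curvAdj_curv_GcolSum_of_coclosed (N := M * L) S a hco
  have hGU := isBlockConst_GcolSum (N := M * L) S a
  set U : Form1 (d + 1) ℝ := GcolSum (N := M * L) S a with hUdef
  obtain ⟨C, _, hbdd, hsum⟩ := Gcol_bdd_summable (N := M) (d := d)
  obtain ⟨CM, _, hMb, hMs⟩ := Mcol_bdd_summable (N := M) (d := d)
  obtain ⟨CΦ, _, hΦ⟩ := Φcol_bdd (N := M) (d := d)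
  have hM : 0 < M := Nat.pos_of_ne_zero (NeZero.ne M)
  -- the pairing computed from `U`'s Euler–Lagrange identity: `⟨U, d*d Γ_M⟩ = ⟨Γ_M, 𝒬_{ML}ᵀ Φ^U + Σ a δ⟩ = 0 + U_M(κ₀, x₀)`
  have sQ : ∀ μ', Summable (fun x => Gcol (N := M) κ₀ x₀ μ' x * contourSumAdj (M * L) (ΦcolSum (N := M * L) S a) μ' x) :=
    fun μ' => summable_mul_of_bdd' (hsum κ₀ x₀ μ') (fun x => abs_contourSumAdj_le hΦUb μ' x)
  have sδ : ∀ μ', Summable (fun x => Gcol (N := M) κ₀ x₀ μ' x * δSum S a μ' x) :=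
    fun μ' => summable_mul_of_bdd' (hsum κ₀ x₀ μ') (abs_δSum_le S a μ')
  have hP0 : lip1 U (curvAdj (curv (Gcol (N := M) κ₀ x₀))) = GcolSum (N := M) S a κ₀ x₀ := by
    rw [lip1_curvAdj hUb (fun κ l => summable_curv (hsum κ₀ x₀) κ l), lip2_comm,
      ← lip1_curvAdj (hbdd κ₀ x₀) (fun κ l => summable_curv hUs κ l), hELU, lip1_add sQ sδ,
      lip1_contourSumAdj (N := M * L) (hsum κ₀ x₀) hΦUb, lip1_Gcol_δSum]
    have hz : ∑' y, ∑ κ, ΦcolSum (N := M * L) S a κ y * contourSum (M * L) (Gcol (N := M) κ₀ x₀) κ y = 0 := by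
      refine (tsum_congr fun y => ?_).trans tsum_zero
      refine Finset.sum_eq_zero fun κ _ => ?_
      have h0 : contourSum M (Gcol (N := M) κ₀ x₀) = 0 := by
        funext κ' y'
        exact Gam_Q (N := M) κ₀ x₀ κ' y'
      have hQ : contourSum (M * L) (Gcol (N := M) κ₀ x₀) κ y = 0 := by
        rw [contourSum_mul M L hM, h0]
        simp [contourSum]
      rw [hQ, mul_zero]
    rw [hz, zero_add]
  -- the pairing computed from `Γ_M`'s Euler–Lagrange identity
  have h1 : lip1 U (contourSumAdj M (Φcol (N := M) κ₀ x₀))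
      = -∑' w' : (Fin (d + 1) → ℤ), ∑ l'' : Fin (d + 1),
          contourSum M U l'' w' * wH (N := M) (d := d) κ₀ l'' (x₀ - (M : ℤ) • w') := by
    rw [lip1_contourSumAdj (N := M) hUs (hΦ κ₀ x₀), ← tsum_neg]
    refine tsum_congr fun w' => ?_
    rw [← Finset.sum_neg_distrib]
    refine Finset.sum_congr rfl fun l'' _ => ?_
    rw [show Φcol (N := M) κ₀ x₀ l'' w' = GamΦ (N := M) l'' w' κ₀ x₀ from rfl, GamΦ_eq_neg_wH]
    ring
  have h2 : lip1 U (dz (codiff₁ (dz (Mcol (N := M) κ₀ x₀)))) = 0 := by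
    have e1 : ∀ x, |codiff₁ U x| ≤ (d + 1 : ℕ) * (2 * K) := fun x => abs_codiff₁_le hUb x
    have e2 : ∀ κ x, |dz (codiff₁ U) κ x| ≤ 2 * ((d + 1 : ℕ) * (2 * K)) := fun κ x => abs_dz_le e1 κ x
    have e3 : ∀ x, |codiff₁ (dz (codiff₁ U)) x| ≤ (d + 1 : ℕ) * (2 * (2 * ((d + 1 : ℕ) * (2 * K)))) :=
      fun x => abs_codiff₁_le e2 x
    have hdzM : ∀ κ, Summable (dz (Mcol (N := M) κ₀ x₀) κ) := fun κ => summable_dz (hMs κ₀ x₀) κ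
    rw [lip1_dz hUb (summable_codiff₁ hdzM), lip0_codiff₁ e1 hdzM, lip1_dz e2 (hMs κ₀ x₀)]
    exact tsum_mul_eq_zero_of_blockConst (N := M) e3 (isBlockConst_of_mul hGU) (hMs κ₀ x₀) (GamM_M (N := M) κ₀ x₀)
  have h3 : lip1 U (δcol κ₀ x₀) = U κ₀ x₀ := by
    unfold lip1
    have e : ∀ x, ∑ μ' : Fin (d + 1), U μ' x * δcol κ₀ x₀ μ' x = if x = x₀ then U κ₀ x₀ else 0 := by
      intro x
      by_cases hx : x = x₀
      · subst hx
        simp [δcol]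
      · simp [δcol, hx]
    rw [tsum_congr e, tsum_eq_single x₀ (fun x hx => if_neg hx), if_pos rfl]
  have sT1 : ∀ μ', Summable (fun x => U μ' x * contourSumAdj M (Φcol (N := M) κ₀ x₀) μ' x) :=
    fun μ' => summable_mul_of_bdd' (hUs μ') (fun x => abs_contourSumAdj_le (hΦ κ₀ x₀) μ' x)
  have hT2b : ∀ μ' x, |dz (codiff₁ (dz (Mcol (N := M) κ₀ x₀))) μ' x| ≤ 2 * ((d + 1 : ℕ) * (2 * (2 * CM))) := fun μ' x =>
    abs_dz_le (fun z => abs_codiff₁_le (fun κ w => abs_dz_le (hMb κ₀ x₀) κ w) z) μ' x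
  have sT2 : ∀ μ', Summable (fun x => U μ' x * dz (codiff₁ (dz (Mcol (N := M) κ₀ x₀))) μ' x) :=
    fun μ' => summable_mul_of_bdd' (hUs μ') (hT2b μ')
  have sδ' : ∀ μ', Summable (fun x => U μ' x * δcol κ₀ x₀ μ' x) := fun μ' =>
    summable_mul_of_bdd' (M := 1) (hUs μ') (fun x => by
      unfold δcol
      split_ifs <;> simp)
  have s12 : ∀ μ', Summable (fun x => U μ' x
      * (contourSumAdj M (Φcol (N := M) κ₀ x₀) + dz (codiff₁ (dz (Mcol (N := M) κ₀ x₀)))) μ' x) := fun μ' => by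
    have h := (sT1 μ').add (sT2 μ')
    simpa only [Pi.add_apply, mul_add] using h
  have hP : lip1 U (curvAdj (curv (Gcol (N := M) κ₀ x₀)))
      = -(∑' w' : (Fin (d + 1) → ℤ), ∑ l'' : Fin (d + 1),
          contourSum M U l'' w' * wH (N := M) (d := d) κ₀ l'' (x₀ - (M : ℤ) • w')) + 0 + U κ₀ x₀ := by
    rw [curvAdj_curv_Gcol, lip1_add s12 sδ', lip1_add sT1 sT2, h1, h2, h3]
  rw [hP0] at hP
  linarith

end Transverse

/-! ## §8 Minimiser fields of exact coarse data are flat; `ℋ_Nᵀ` maps co-closed test forms to coarse co-closed forms (v4)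

Step (S2) of the all-`j` (K1aᵀ) plan.  Three elementary facts about FINITE SUPERPOSITIONS `Σ_t c_t ℋ_N(·; t)` of translated
minimiser columns: (i) their constraint multipliers are COARSE CO-CLOSED (`codiff₁ ∘ curvAdj = 0` + §1's
`codiff₁_contourSumAdj`); (ii) the ENERGY IDENTITY `Σ |curv H|² = Σ_t c_t Φ^H(t)` (pairing (EL) against `H` itself, (Q) of
the columns); hence (iii) the minimiser field of the coarse EXACT datum `−d_c δ_{y₀}` has energy `(codiff₁ Φ^H)(y₀) = 0`,
i.e. it is FLAT.  The lattice Poincaré lemma (closed 1-forms on `ℤ^{d+1}` are exact — a staircase potential) and summation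
by parts against a finitely supported co-closed test form then give (S2). -/

section Flat

open KKTFluctuationEnergy (abs_curv_le summable_curv)
open KernelSpecInstance (curv_add curv_smul curvAdj_add curvAdj_smul contourSumAdj_add contourSumAdj_smul)

variable {d : ℕ} [NeZero N]

/-- A finite superposition `Σ_{t ∈ T} c_t ℋ_N(·; t)` of translated minimiser columns. [folklore] -/
def HcolSum (T : Finset (Fin (d + 1) × AffineAveraging.Site (d + 1))) (c : Fin (d + 1) × AffineAveraging.Site (d + 1) → ℝ) :
    Form1 (d + 1) ℝ :=
  fun κ x => ∑ t ∈ T, c t * Hcol (N := N) t.1 t.2 κ x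

/-- Its constraint multiplier `Σ_{t ∈ T} c_t Φ^ℋ(·; t)`. [folklore] -/
def HΦcolSum (T : Finset (Fin (d + 1) × AffineAveraging.Site (d + 1))) (c : Fin (d + 1) × AffineAveraging.Site (d + 1) → ℝ) :
    Form1 (d + 1) ℝ :=
  fun κ y => ∑ t ∈ T, c t * HΦcol (N := N) t.1 t.2 κ y

/-- `Σ_{insert t T} = c_t ℋ_t + Σ_T`. [folklore] -/
theorem HcolSum_insert {t : Fin (d + 1) × AffineAveraging.Site (d + 1)}
    {T : Finset (Fin (d + 1) × AffineAveraging.Site (d + 1))} (ht : t ∉ T)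
    (c : Fin (d + 1) × AffineAveraging.Site (d + 1) → ℝ) :
    HcolSum (N := N) (insert t T) c = c t • Hcol (N := N) t.1 t.2 + HcolSum (N := N) T c := by
  funext κ x
  simp [HcolSum, Finset.sum_insert ht]

/-- `Σ_{insert t T} = c_t Φ_t + Σ_T`. [folklore] -/
theorem HΦcolSum_insert {t : Fin (d + 1) × AffineAveraging.Site (d + 1)}
    {T : Finset (Fin (d + 1) × AffineAveraging.Site (d + 1))} (ht : t ∉ T)
    (c : Fin (d + 1) × AffineAveraging.Site (d + 1) → ℝ) :
    HΦcolSum (N := N) (insert t T) c = c t • HΦcol (N := N) t.1 t.2 + HΦcolSum (N := N) T c := by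
  funext κ y
  simp [HΦcolSum, Finset.sum_insert ht]

/-- (EL) of a superposition of minimiser columns: `d*d H = 𝒬ᵀ Φ^H` (no gauge term, no force). [folklore] -/
theorem curvAdj_curv_HcolSum (T : Finset (Fin (d + 1) × AffineAveraging.Site (d + 1)))
    (c : Fin (d + 1) × AffineAveraging.Site (d + 1) → ℝ) :
    curvAdj (curv (HcolSum (N := N) T c)) = contourSumAdj N (HΦcolSum (N := N) T c) := by
  classical
  induction T using Finset.induction_on with
  | empty =>
    funext μ x
    simp [HcolSum, HΦcolSum, curvAdj, curv, contourSumAdj_eq]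
  | @insert t T ht ih =>
    rw [HcolSum_insert ht, HΦcolSum_insert ht, curv_add, curv_smul, curvAdj_add, curvAdj_smul, ih, curvAdj_curv_Hcol,
      contourSumAdj_add, contourSumAdj_smul]

/-- (Q) of a superposition: `(𝒬 H)(κ, y) = Σ_t c_t [(κ, y) = t]`. [folklore] -/
theorem contourSum_HcolSum (T : Finset (Fin (d + 1) × AffineAveraging.Site (d + 1)))
    (c : Fin (d + 1) × AffineAveraging.Site (d + 1) → ℝ) (κ : Fin (d + 1)) (y : AffineAveraging.Site (d + 1)) :
    contourSum N (HcolSum (N := N) T c) κ y = ∑ t ∈ T, c t * (if y = t.2 ∧ κ = t.1 then 1 else 0) := by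
  rw [show HcolSum (N := N) T c = fun κ x => ∑ t ∈ T, (fun κ' x' => c t * Hcol (N := N) t.1 t.2 κ' x') κ x from rfl,
    contourSum_finset_sum]
  refine Finset.sum_congr rfl fun t _ => ?_
  rw [contourSum_const_mul, contourSum_Hcol]

/-- Uniform bound and summability of a superposition and a uniform bound of its multiplier. [folklore] -/
theorem HcolSum_bdd_summable (T : Finset (Fin (d + 1) × AffineAveraging.Site (d + 1)))
    (c : Fin (d + 1) × AffineAveraging.Site (d + 1) → ℝ) :
    ∃ C : ℝ, (∀ κ x, |HcolSum (N := N) T c κ x| ≤ C) ∧ (∀ κ, Summable (HcolSum (N := N) T c κ))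
      ∧ (∀ κ y, |HΦcolSum (N := N) T c κ y| ≤ C) := by
  obtain ⟨C, _, hbdd, hsum⟩ := Hcol_bdd_summable (N := N) (d := d)
  obtain ⟨CΦ, _, hΦ⟩ := HΦcol_bdd (N := N) (d := d)
  refine ⟨(∑ t ∈ T, |c t|) * (C + CΦ), fun κ x => ?_, fun κ => ?_, fun κ y => ?_⟩
  · refine (abs_sum_mul_le T c _ fun t _ => hbdd t.1 t.2 κ x).trans ?_
    exact mul_le_mul_of_nonneg_left (by linarith) (Finset.sum_nonneg fun t _ => abs_nonneg _)
  · exact summable_sum fun t _ => (hsum t.1 t.2 κ).mul_left (c t)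
  · refine (abs_sum_mul_le T c _ fun t _ => hΦ t.1 t.2 κ y).trans ?_
    exact mul_le_mul_of_nonneg_left (by linarith) (Finset.sum_nonneg fun t _ => abs_nonneg _)

/-- **CONSTRAINT MULTIPLIERS OF MINIMISER SUPERPOSITIONS ARE COARSE CO-CLOSED**: `codiff₁ Φ^H = 0` — apply `codiff₁` to
(EL): `0 = codiff₁ (d*d H) = codiff₁ (𝒬ᵀ Φ^H) = (codiff₁ Φ^H) ∘ quo`. [folklore] -/
theorem codiff₁_HΦcolSum (T : Finset (Fin (d + 1) × AffineAveraging.Site (d + 1)))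
    (c : Fin (d + 1) × AffineAveraging.Site (d + 1) → ℝ) : codiff₁ (HΦcolSum (N := N) T c) = 0 := by
  funext y
  have h := congrArg codiff₁ (curvAdj_curv_HcolSum (N := N) T c)
  rw [codiff₁_curvAdj] at h
  have h' := congr_fun h ((N : ℤ) • y)
  rw [Pi.zero_apply, codiff₁_contourSumAdj, quo_zsmul'] at h'
  rw [Pi.zero_apply, ← h']

omit [NeZero N] in
/-- `Σ'_y Σ_κ Φ_κ(y) [(κ, y) = t] = Φ(t)`. [folklore] -/
theorem tsum_sum_mul_indicator (Φ : Form1 (d + 1) ℝ) (t : Fin (d + 1) × AffineAveraging.Site (d + 1)) :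
    ∑' y, ∑ κ, Φ κ y * (if y = t.2 ∧ κ = t.1 then (1 : ℝ) else 0) = Φ t.1 t.2 := by
  have e : ∀ y, ∑ κ, Φ κ y * (if y = t.2 ∧ κ = t.1 then (1 : ℝ) else 0) = if y = t.2 then Φ t.1 y else 0 := by
    intro y
    by_cases hy : y = t.2
    · simp [hy, Finset.sum_ite_eq']
    · simp [hy]
  rw [tsum_congr e, tsum_eq_single t.2 (fun y hy => if_neg hy), if_pos rfl]

/-- **THE ENERGY IDENTITY** `Σ |curv H|² = Σ_{t ∈ T} c_t Φ^H(t)` for a superposition of minimiser columns: pair (EL)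
against `H` itself and use (Q) of the columns. [folklore] -/
theorem lip2_curv_HcolSum (T : Finset (Fin (d + 1) × AffineAveraging.Site (d + 1)))
    (c : Fin (d + 1) × AffineAveraging.Site (d + 1) → ℝ) :
    lip2 (curv (HcolSum (N := N) T c)) (curv (HcolSum (N := N) T c)) = ∑ t ∈ T, c t * HΦcolSum (N := N) T c t.1 t.2 := by
  obtain ⟨C, hHb, hHs, hΦb⟩ := HcolSum_bdd_summable (N := N) T c
  rw [← lip1_curvAdj hHb (fun κ l => summable_curv hHs κ l), curvAdj_curv_HcolSum,
    lip1_contourSumAdj (N := N) hHs hΦb]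
  have e1 : ∀ y, ∑ κ, HΦcolSum (N := N) T c κ y * contourSum N (HcolSum (N := N) T c) κ y
      = ∑ t ∈ T, ∑ κ, c t * (HΦcolSum (N := N) T c κ y * (if y = t.2 ∧ κ = t.1 then (1 : ℝ) else 0)) := by
    intro y
    rw [Finset.sum_comm]
    refine Finset.sum_congr rfl fun κ _ => ?_
    rw [contourSum_HcolSum, Finset.mul_sum]
    refine Finset.sum_congr rfl fun t _ => ?_
    ring
  have hs : ∀ t ∈ T, Summable (fun y => ∑ κ, c t * (HΦcolSum (N := N) T c κ y * (if y = t.2 ∧ κ = t.1 then (1 : ℝ) else 0))) := by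
    intro t _
    refine summable_of_ne_finset_zero (s := {t.2}) fun y hy => ?_
    rw [Finset.mem_singleton] at hy
    simp [hy]
  rw [tsum_congr e1, Summable.tsum_finsetSum hs]
  refine Finset.sum_congr rfl fun t _ => ?_
  rw [show (fun y => ∑ κ, c t * (HΦcolSum (N := N) T c κ y * (if y = t.2 ∧ κ = t.1 then (1 : ℝ) else 0)))
      = fun y => c t * ∑ κ, HΦcolSum (N := N) T c κ y * (if y = t.2 ∧ κ = t.1 then (1 : ℝ) else 0) from
      funext fun y => by rw [Finset.mul_sum], tsum_mul_left, tsum_sum_mul_indicator]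

/-- A nonnegative energy density with zero total forces `curv H = 0`. [folklore] -/
theorem curv_eq_zero_of_lip2 {H : Form1 (d + 1) ℝ} {C : ℝ} (hHb : ∀ κ x, |H κ x| ≤ C) (hHs : ∀ κ, Summable (H κ))
    (h0 : lip2 (curv H) (curv H) = 0) : curv H = 0 := by
  have hnn : ∀ x, 0 ≤ ∑ κ, ∑ l, curv H κ l x * curv H κ l x :=
    fun x => Finset.sum_nonneg fun κ _ => Finset.sum_nonneg fun l _ => mul_self_nonneg _
  have hs : Summable (fun x => ∑ κ, ∑ l, curv H κ l x * curv H κ l x) :=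
    summable_sum fun κ _ => summable_sum fun l _ => summable_mul_of_bdd (abs_curv_le hHb κ l) (summable_curv hHs κ l)
  have hz := (hasSum_zero_iff_of_nonneg hnn).1 (by unfold lip2 at h0; rw [← h0]; exact hs.hasSum)
  funext κ l x
  have hx : ∑ κ, ∑ l, curv H κ l x * curv H κ l x = 0 := congr_fun hz x
  have hκ := (Finset.sum_eq_zero_iff_of_nonneg (fun κ _ => Finset.sum_nonneg fun l _ =>
    mul_self_nonneg (curv H κ l x))).1 hx κ (Finset.mem_univ κ)
  exact mul_self_eq_zero.mp ((Finset.sum_eq_zero_iff_of_nonneg (fun l _ => mul_self_nonneg (curv H κ l x))).1 hκ l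
    (Finset.mem_univ l))

omit [NeZero N] in
/-- The coarse sites carrying the datum `−d_c δ_{y₀}`: `y₀` and its backward neighbours. [folklore] -/
def exY (y₀ : AffineAveraging.Site (d + 1)) : Finset (AffineAveraging.Site (d + 1)) :=
  insert y₀ (Finset.univ.image fun l : Fin (d + 1) => y₀ - unitVec l)

omit [NeZero N] in
/-- The index set of the exact datum (all directions × `exY y₀`). [folklore] -/
def Tex (y₀ : AffineAveraging.Site (d + 1)) : Finset (Fin (d + 1) × AffineAveraging.Site (d + 1)) :=
  Finset.univ ×ˢ exY y₀

omit [NeZero N] in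
/-- The coefficients of the exact datum: `+1` on the bond `(l, y₀ − e_l)`, `−1` on `(l, y₀)` — i.e. minus the coarse
gradient of the point mass at `y₀`. [folklore] -/
def cex (y₀ : AffineAveraging.Site (d + 1)) : Fin (d + 1) × AffineAveraging.Site (d + 1) → ℝ :=
  fun t => (if t.2 = y₀ - unitVec t.1 then 1 else 0) - (if t.2 = y₀ then 1 else 0)

omit [NeZero N] in
/-- Pairing with the exact datum is (minus) the coarse codifferential at `y₀`:
`Σ_{t ∈ Tex} cex(t) f(t) = Σ_l (f(l, y₀ − e_l) − f(l, y₀))`. [folklore] -/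
theorem sum_Tex (y₀ : AffineAveraging.Site (d + 1)) (f : Fin (d + 1) × AffineAveraging.Site (d + 1) → ℝ) :
    ∑ t ∈ Tex y₀, cex y₀ t * f t = ∑ l, (f (l, y₀ - unitVec l) - f (l, y₀)) := by
  rw [Tex, Finset.sum_product]
  refine Finset.sum_congr rfl fun l _ => ?_
  have hm1 : y₀ - unitVec l ∈ exY y₀ :=
    Finset.mem_insert_of_mem (Finset.mem_image_of_mem _ (Finset.mem_univ l))
  have hm0 : y₀ ∈ exY y₀ := Finset.mem_insert_self _ _
  simp only [cex, sub_mul, ite_mul, one_mul, zero_mul, Finset.sum_sub_distrib, Finset.sum_ite_eq', if_pos hm1,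
    if_pos hm0]

/-- **MINIMISER FIELDS OF EXACT COARSE DATA ARE FLAT**: `curv (ℋ_N(−d_c δ_{y₀})) = 0` — its energy is
`Σ_l (Φ(l, y₀ − e_l) − Φ(l, y₀)) = (codiff₁ Φ)(y₀) = 0`. [folklore] -/
theorem curv_HcolSum_Tex (y₀ : AffineAveraging.Site (d + 1)) : curv (HcolSum (N := N) (Tex y₀) (cex y₀)) = 0 := by
  obtain ⟨C, hHb, hHs, _⟩ := HcolSum_bdd_summable (N := N) (Tex y₀) (cex y₀)
  refine curv_eq_zero_of_lip2 hHb hHs ?_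
  rw [lip2_curv_HcolSum, sum_Tex]
  have h := congr_fun (codiff₁_HΦcolSum (N := N) (Tex y₀) (cex y₀)) y₀
  simpa only [codiff₁, Pi.zero_apply] using h

end Flat

section Poincare

/-! ### The lattice Poincaré lemma `H¹(ℤ^D) = 0`: a closed 1-form is the differential of its staircase potential -/

/-- Signed partial sums along a lattice line: `lineSum f 0 = 0` and `lineSum f (n + 1) = lineSum f n + f n` for EVERY
`n : ℤ`. [folklore] -/
def lineSum (f : ℤ → ℝ) (n : ℤ) : ℝ :=
  (∑ i ∈ Finset.range n.toNat, f i) - ∑ i ∈ Finset.range (-n).toNat, f (-1 - i)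

/-- `lineSum f 0 = 0`. [folklore] -/
theorem lineSum_zero (f : ℤ → ℝ) : lineSum f 0 = 0 := by
  simp [lineSum]

/-- The step relation on all of `ℤ`. [folklore] -/
theorem lineSum_succ (f : ℤ → ℝ) (n : ℤ) : lineSum f (n + 1) = lineSum f n + f n := by
  unfold lineSum
  by_cases hn : 0 ≤ n
  · have e1 : (n + 1).toNat = n.toNat + 1 := by omega
    have e2 : (-(n + 1)).toNat = 0 := by omega
    have e3 : (-n).toNat = 0 := by omega
    have e4 : ((n.toNat : ℕ) : ℤ) = n := by omega
    rw [e1, e2, e3, Finset.sum_range_succ, e4]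
    simp
  · have hn' : n < 0 := not_le.mp hn
    have e1 : (n + 1).toNat = 0 := by omega
    have e2 : n.toNat = 0 := by omega
    have e3 : (-n).toNat = (-(n + 1)).toNat + 1 := by omega
    have e4 : (-1 : ℤ) - (((-(n + 1)).toNat : ℕ) : ℤ) = n := by omega
    rw [e1, e2, e3, Finset.sum_range_succ, e4]
    simp only [Finset.range_zero, Finset.sum_empty]
    ring

/-- `lineSum` is additive (difference form). [folklore] -/
theorem lineSum_sub (f g : ℤ → ℝ) (n : ℤ) : lineSum (fun t => f t - g t) n = lineSum f n - lineSum g n := by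
  simp only [lineSum, Finset.sum_sub_distrib]
  ring

/-- Telescoping on all of `ℤ`: `lineSum (h(·+1) − h) n = h n − h 0`. [folklore] -/
theorem lineSum_sub_telescope (h : ℤ → ℝ) (n : ℤ) : lineSum (fun t => h (t + 1) - h t) n = h n - h 0 := by
  induction n using Int.induction_on with
  | zero => simp [lineSum_zero]
  | succ i ih => rw [lineSum_succ, ih]; ring
  | pred i ih =>
    have e := lineSum_succ (fun t => h (t + 1) - h t) (-(i : ℤ) - 1)
    rw [show -(i : ℤ) - 1 + 1 = -(i : ℤ) by ring, ih] at e
    linarith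

/-- Truncation of a site: keep the coordinates of index `< m`, zero the others. [folklore] -/
def truncSite (m : ℕ) (x : AffineAveraging.Site D) : AffineAveraging.Site D := fun i => if (i : ℕ) < m then x i else 0

/-- Full truncation is the identity. [folklore] -/
theorem truncSite_of_le {m : ℕ} (hm : D ≤ m) (x : AffineAveraging.Site D) : truncSite m x = x := by
  funext i
  simp [truncSite, lt_of_lt_of_le i.isLt hm]

/-- One more coordinate: `trunc_{m+1} x = trunc_m x + x_m e_m`. [folklore] -/
theorem truncSite_succ {m : ℕ} (hm : m < D) (x : AffineAveraging.Site D) :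
    truncSite (m + 1) x = truncSite m x + x ⟨m, hm⟩ • unitVec (⟨m, hm⟩ : Fin D) := by
  funext i
  simp only [truncSite, Pi.add_apply, Pi.smul_apply, unitVec_apply, smul_eq_mul]
  by_cases h1 : (i : ℕ) < m
  · have hne : i ≠ ⟨m, hm⟩ := fun h => by rw [h] at h1; exact lt_irrefl _ h1
    simp [h1, show (i : ℕ) < m + 1 by omega, hne]
  · by_cases h2 : i = ⟨m, hm⟩
    · subst h2
      simp
    · have h3 : ¬ (i : ℕ) < m + 1 := fun h => h2 (Fin.ext (show (i : ℕ) = m by omega))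
      simp [h1, h3, h2]

/-- Truncation below the moved coordinate does not see the move. [folklore] -/
theorem truncSite_add_unitVec_of_le {m : ℕ} {k : Fin D} (h : m ≤ (k : ℕ)) (x : AffineAveraging.Site D) :
    truncSite m (x + unitVec k) = truncSite m x := by
  funext i
  simp only [truncSite, Pi.add_apply, unitVec_apply]
  by_cases h1 : (i : ℕ) < m
  · have hne : i ≠ k := fun hik => by rw [hik] at h1; omega
    simp [h1, hne]
  · simp [h1]

/-- Truncation above the moved coordinate commutes with the move. [folklore] -/
theorem truncSite_add_unitVec_of_lt {m : ℕ} {k : Fin D} (h : (k : ℕ) < m) (x : AffineAveraging.Site D) :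
    truncSite m (x + unitVec k) = truncSite m x + unitVec k := by
  funext i
  simp only [truncSite, Pi.add_apply, unitVec_apply]
  by_cases h1 : (i : ℕ) < m
  · simp [h1]
  · have hne : i ≠ k := fun hik => by rw [hik] at h1; exact h1 h
    simp [h1, hne]

/-- THE STAIRCASE POTENTIAL of a 1-form: integrate `A` along the coordinate staircase from `0` to `x`
(leg `k` runs from `trunc_k x` to `trunc_{k+1} x` along `e_k`). [folklore] -/
def stairPot (A : Form1 D ℝ) : Form0 D ℝ :=
  fun x => ∑ k : Fin D, lineSum (fun t => A k (truncSite k x + t • unitVec k)) (x k)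

/-- The increment of leg `m` of the staircase under `x ↦ x + e_k`. [folklore] -/
def stairInc (A : Form1 D ℝ) (k : Fin D) (x : AffineAveraging.Site D) (m : ℕ) : ℝ :=
  if hm : m < D then
    lineSum (fun t => A ⟨m, hm⟩ (truncSite m (x + unitVec k) + t • unitVec (⟨m, hm⟩ : Fin D))) ((x + unitVec k) ⟨m, hm⟩)
      - lineSum (fun t => A ⟨m, hm⟩ (truncSite m x + t • unitVec (⟨m, hm⟩ : Fin D))) (x ⟨m, hm⟩)
  else 0

/-- Legs below `k` do not move. [folklore] -/
theorem stairInc_of_lt (A : Form1 D ℝ) (k : Fin D) (x : AffineAveraging.Site D) {m : ℕ} (hm : m < (k : ℕ)) :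
    stairInc A k x m = 0 := by
  have hmD : m < D := hm.trans k.isLt
  have hne : (⟨m, hmD⟩ : Fin D) ≠ k := fun h => by rw [← h] at hm; exact lt_irrefl _ hm
  simp only [stairInc, dif_pos hmD, truncSite_add_unitVec_of_le hm.le, Pi.add_apply, unitVec_apply, if_neg hne,
    add_zero, sub_self]

/-- Leg `k` gains one step: `A_k(trunc_{k+1} x)`. [folklore] -/
theorem stairInc_self (A : Form1 D ℝ) (k : Fin D) (x : AffineAveraging.Site D) :
    stairInc A k x k = A k (truncSite ((k : ℕ) + 1) x) := by
  simp [stairInc, truncSite_add_unitVec_of_le le_rfl, lineSum_succ, truncSite_succ k.isLt]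

/-- Legs above `k` are translated by `e_k`; by closedness their increment telescopes to
`A_k(trunc_{m+1} x) − A_k(trunc_m x)`. [folklore] -/
theorem stairInc_of_gt {A : Form1 D ℝ} (hA : curv A = 0) (k : Fin D) (x : AffineAveraging.Site D) {m : ℕ}
    (hkm : (k : ℕ) < m) (hmD : m < D) :
    stairInc A k x m = A k (truncSite (m + 1) x) - A k (truncSite m x) := by
  have hne : (⟨m, hmD⟩ : Fin D) ≠ k := fun h => by rw [← h] at hkm; exact lt_irrefl _ hkm
  have hcl : ∀ q : AffineAveraging.Site D, A ⟨m, hmD⟩ (q + unitVec k) - A ⟨m, hmD⟩ q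
      = A k (q + unitVec ⟨m, hmD⟩) - A k q := by
    intro q
    have h := congr_fun (congr_fun (congr_fun hA k) ⟨m, hmD⟩) q
    simp only [curv, Pi.zero_apply] at h
    linarith
  simp only [stairInc, dif_pos hmD, truncSite_add_unitVec_of_lt hkm, Pi.add_apply, unitVec_apply, if_neg hne, add_zero]
  rw [← lineSum_sub]
  have e : ∀ t : ℤ, A ⟨m, hmD⟩ (truncSite m x + unitVec k + t • unitVec (⟨m, hmD⟩ : Fin D))
        - A ⟨m, hmD⟩ (truncSite m x + t • unitVec (⟨m, hmD⟩ : Fin D))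
      = A k (truncSite m x + (t + 1) • unitVec (⟨m, hmD⟩ : Fin D))
        - A k (truncSite m x + t • unitVec (⟨m, hmD⟩ : Fin D)) := by
    intro t
    have h := hcl (truncSite m x + t • unitVec (⟨m, hmD⟩ : Fin D))
    rw [show truncSite m x + unitVec k + t • unitVec (⟨m, hmD⟩ : Fin D)
        = truncSite m x + t • unitVec (⟨m, hmD⟩ : Fin D) + unitVec k by abel,
      show truncSite m x + (t + 1) • unitVec (⟨m, hmD⟩ : Fin D)
        = truncSite m x + t • unitVec (⟨m, hmD⟩ : Fin D) + unitVec ⟨m, hmD⟩ by rw [add_smul, one_smul, add_assoc]]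
    exact h
  calc lineSum (fun t => A ⟨m, hmD⟩ (truncSite m x + unitVec k + t • unitVec (⟨m, hmD⟩ : Fin D))
          - A ⟨m, hmD⟩ (truncSite m x + t • unitVec (⟨m, hmD⟩ : Fin D))) (x ⟨m, hmD⟩)
      = lineSum (fun t => A k (truncSite m x + (t + 1) • unitVec (⟨m, hmD⟩ : Fin D))
          - A k (truncSite m x + t • unitVec (⟨m, hmD⟩ : Fin D))) (x ⟨m, hmD⟩) := by
        congr 1
        funext t
        exact e t
    _ = A k (truncSite m x + x ⟨m, hmD⟩ • unitVec (⟨m, hmD⟩ : Fin D))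
          - A k (truncSite m x + (0 : ℤ) • unitVec (⟨m, hmD⟩ : Fin D)) :=
        lineSum_sub_telescope (fun t => A k (truncSite m x + t • unitVec (⟨m, hmD⟩ : Fin D))) _
    _ = A k (truncSite (m + 1) x) - A k (truncSite m x) := by
        rw [zero_smul, add_zero, truncSite_succ hmD]

/-- **THE LATTICE POINCARÉ LEMMA** `H¹(ℤ^D) = 0`: a closed 1-form is the differential of its staircase potential. [folklore] -/
theorem dz_stairPot {A : Form1 D ℝ} (hA : curv A = 0) : dz (stairPot A) = A := by
  funext k x
  have hk : (k : ℕ) < D := k.isLt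
  set a : ℕ → ℝ := fun m => A k (truncSite m x) with ha
  have hgt : ∀ m ∈ Finset.range (D - ((k : ℕ) + 1)),
      stairInc A k x ((k : ℕ) + 1 + m) = a ((k : ℕ) + 1 + (m + 1)) - a ((k : ℕ) + 1 + m) := by
    intro m hm
    have hm' := Finset.mem_range.mp hm
    rw [stairInc_of_gt hA k x (by omega) (by omega), Nat.add_assoc]
  calc dz (stairPot A) k x = ∑ k' : Fin D, stairInc A k x k' := by
        simp only [dz, stairPot, ← Finset.sum_sub_distrib]
        refine Finset.sum_congr rfl fun k' _ => ?_
        simp only [stairInc, dif_pos k'.isLt, Fin.eta]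
    _ = ∑ m ∈ Finset.range D, stairInc A k x m := Fin.sum_univ_eq_sum_range (stairInc A k x) D
    _ = ∑ m ∈ Finset.Ico 0 (k : ℕ), stairInc A k x m
          + (stairInc A k x k + ∑ m ∈ Finset.Ico ((k : ℕ) + 1) D, stairInc A k x m) := by
        rw [Finset.range_eq_Ico, ← Finset.sum_Ico_consecutive (stairInc A k x) (Nat.zero_le (k : ℕ)) hk.le,
          Finset.sum_eq_sum_Ico_succ_bot hk]
    _ = 0 + (a ((k : ℕ) + 1) + (a D - a ((k : ℕ) + 1))) := by
        congr 1
        · exact Finset.sum_eq_zero fun m hm => stairInc_of_lt A k x (Finset.mem_Ico.mp hm).2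
        · rw [stairInc_self, Finset.sum_Ico_eq_sum_range, Finset.sum_congr rfl hgt,
            Finset.sum_range_sub (fun m => a ((k : ℕ) + 1 + m)), show (k : ℕ) + 1 + (D - ((k : ℕ) + 1)) = D by omega,
            add_zero]
    _ = A k x := by
        rw [zero_add, ha]
        simp only
        rw [truncSite_of_le le_rfl]
        ring

/-- `H¹(ℤ^D) = 0`. [folklore] -/
theorem exists_dz_eq_of_curv_eq_zero {A : Form1 D ℝ} (hA : curv A = 0) : ∃ g : Form0 D ℝ, dz g = A :=
  ⟨stairPot A, dz_stairPot hA⟩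

end Poincare

section CoarseCoclosed

variable {d : ℕ}

/-- SUMMATION BY PARTS AGAINST A FINITELY SUPPORTED 1-FORM (no decay needed on the potential):
`⟨F, dg⟩ = Σ'_x g(x) (codiff₁ F)(x)`. [folklore] -/
theorem lip1_dz_of_finite {D : ℕ} (F : Form1 D ℝ) (hF : ∀ κ, (Function.support (F κ)).Finite) (g : Form0 D ℝ) :
    lip1 F (dz g) = ∑' x, g x * codiff₁ F x := by
  have hz : ∀ μ x, x ∉ (hF μ).toFinset → F μ x = 0 := fun μ x hx => by
    simpa [Set.Finite.mem_toFinset] using hx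
  have hs1 : ∀ μ, Summable (fun x => F μ x * g (x + unitVec μ)) := fun μ =>
    summable_of_ne_finset_zero (s := (hF μ).toFinset) fun x hx => by rw [hz μ x hx, zero_mul]
  have hs0 : ∀ μ, Summable (fun x => F μ x * g x) := fun μ =>
    summable_of_ne_finset_zero (s := (hF μ).toFinset) fun x hx => by rw [hz μ x hx, zero_mul]
  have hs2 : ∀ μ, Summable (fun x => F μ (x - unitVec μ) * g x) := fun μ =>
    summable_of_ne_finset_zero (s := ((hF μ).toFinset).image (· + unitVec μ)) fun x hx => by
      have hx' : x - unitVec μ ∉ (hF μ).toFinset := fun h =>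
        hx (Finset.mem_image.mpr ⟨x - unitVec μ, h, sub_add_cancel x _⟩)
      rw [hz μ _ hx', zero_mul]
  have hshift : ∀ μ, ∑' x, F μ x * g (x + unitVec μ) = ∑' x, F μ (x - unitVec μ) * g x := fun μ => by
    rw [← (Equiv.subRight (unitVec μ)).tsum_eq (fun x => F μ x * g (x + unitVec μ))]
    exact tsum_congr fun x => by simp [Equiv.subRight, sub_add_cancel]
  have e1 : ∀ x, ∑ μ, F μ x * dz g μ x = ∑ μ, (F μ x * g (x + unitVec μ) - F μ x * g x) := fun x =>
    Finset.sum_congr rfl fun μ _ => by simp only [dz]; ring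
  have e2 : ∀ μ, ∑' x, (F μ x * g (x + unitVec μ) - F μ x * g x) = ∑' x, (F μ (x - unitVec μ) - F μ x) * g x := by
    intro μ
    rw [(hs1 μ).tsum_sub (hs0 μ), hshift μ, ← (hs2 μ).tsum_sub (hs0 μ)]
    exact tsum_congr fun x => by ring
  have hs3 : ∀ μ, Summable (fun x => (F μ (x - unitVec μ) - F μ x) * g x) := fun μ =>
    ((hs2 μ).sub (hs0 μ)).congr fun x => by ring
  unfold lip1
  rw [tsum_congr e1, Summable.tsum_finsetSum (fun μ _ => (hs1 μ).sub (hs0 μ)), Finset.sum_congr rfl fun μ _ => e2 μ,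
    ← Summable.tsum_finsetSum (fun μ _ => hs3 μ)]
  refine tsum_congr fun x => ?_
  simp only [codiff₁, Finset.mul_sum]
  exact Finset.sum_congr rfl fun μ _ => by ring

/-- A finitely supported CO-CLOSED 1-form pairs to zero with every FLAT 1-form (Poincaré + summation by parts). [folklore] -/
theorem lip1_eq_zero_of_curv_eq_zero {D : ℕ} (F : Form1 D ℝ) (hF : ∀ κ, (Function.support (F κ)).Finite)
    (hco : codiff₁ F = 0) {A : Form1 D ℝ} (hA : curv A = 0) : lip1 F A = 0 := by
  obtain ⟨g, hg⟩ := exists_dz_eq_of_curv_eq_zero hA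
  rw [← hg, lip1_dz_of_finite F hF g, hco]
  simp

/-- **(S2) `ℋ_Nᵀ` MAPS FINITELY SUPPORTED CO-CLOSED TEST FORMS TO COARSE CO-CLOSED FORMS**: for `ζ(l, y) := ⟨F, ℋ_N(·; l, y)⟩`,
`codiff₁ ζ = 0` — because `(codiff₁ ζ)(y₀) = ⟨F, ℋ_N(−d_c δ_{y₀})⟩` and that minimiser field is flat
(`curv_HcolSum_Tex`). [folklore] -/
theorem codiff₁_lip1_Hcol [NeZero N] (F : Form1 (d + 1) ℝ) (hF : ∀ κ, (Function.support (F κ)).Finite)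
    (hco : codiff₁ F = 0) : codiff₁ (fun l y => lip1 F (Hcol (N := N) l y)) = 0 := by
  funext y₀
  have hz : ∀ μ x, x ∉ (hF μ).toFinset → F μ x = 0 := fun μ x hx => by
    simpa [Set.Finite.mem_toFinset] using hx
  have hs : ∀ t ∈ Tex y₀, ∀ μ, Summable (fun x => F μ x * (fun t : Fin (d + 1) × AffineAveraging.Site (d + 1) =>
      Hcol (N := N) t.1 t.2) t μ x) := fun t _ μ =>
    summable_of_ne_finset_zero (s := (hF μ).toFinset) fun x hx => by rw [hz μ x hx, zero_mul]
  have h := lip1_sum_right' (Tex y₀) (cex y₀) (fun t => Hcol (N := N) t.1 t.2) F hs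
  have hflat := lip1_eq_zero_of_curv_eq_zero F hF hco (curv_HcolSum_Tex (N := N) y₀)
  rw [show HcolSum (N := N) (Tex y₀) (cex y₀) = fun μ x => ∑ t ∈ Tex y₀, cex y₀ t * Hcol (N := N) t.1 t.2 μ x from rfl,
    h, sum_Tex] at hflat
  simpa only [codiff₁, Pi.zero_apply] using hflat

end CoarseCoclosed

end

end Literature.MathematicalPhysics.QuantumFieldTheory.Balaban1983to89.Beta.ResolventComposition
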